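import Literature.Computability.FineGrained.SerfSNPInSNPProofs
import Literature.Computability.Cryptography.SNPProofs
import Literature.Computability.Cryptography.SubexponentialProofs
import Literature.Computability.Complexity.IterateFPPoly
import Literature.Computability.Complexity.FoldCatBricks
import HarnessLib

/-!
# `k`-SAT is SNP-complete under SERF reductions: `(∀ k ≥ 3, k-SAT ∈ SE) ↔ SNP ⊆ SE` (discharge)

Sibling proof file of `SerfSNP.lean` (D-0014), discharging the named fact

* `Literature.Computability.FineGrained.forall_kSATParam_mem_SE_iff_SNP_subset_SE_holds :
  forall_kSATParam_mem_SE_iff_SNP_subset_SE` — `(∀ k ≥ 3, kSATParam k ∈ SE) ↔ SNP ⊆ SE`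
  (Impagliazzo–Paturi–Zane, JCSS 63 (2001), §3, Thm. 3: "`k`-SAT is SNP-complete under SERF-reductions …
  Consequently, `k`-SAT ∈ SE if and only if SNP ⊆ SE"; FOCS 1998 version §3, Thm. 1).

## The printed proof and its formalisation

`(←)` "`k`-SAT is in SNP" (IPZ §3): for every `k` the tree's `exists_snp_kSAT_holds`
(`SerfSNPInSNPProofs.lean`) provides an SNP formula `Φ` with `SERFReducible (kSATParam k) Φ.toParamProblem`,
and `SE` is closed under SERF reductions (`mem_SE_of_serfReducible_holds`, `SubexponentialProofs.lean`;
IPZ §2.1, Lemma 9 of the FOCS version).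

`(→)` IPZ, the theorem preceding Thm. 3 (FOCS Thm. 2): "Let `A ∈ SNP`. Then there is a `k` so that `A` has
a strong many-one reduction to `k`-SAT with parameter `n`. Proof: Let `∃R₁⋯∃R_q ∀z₁⋯∀z_r Φ(I, R̄, z̄)` be
the formula representing `A` … Let `k` be the number of occurrences of the relation symbols `R₁, …, R_q` in
`Φ`. For each `αᵢ`-tuple `ȳ` of elements of the universe, introduce a variable `x_{i,ȳ}` representing
whether `Rᵢ(ȳ)` is true. Note that we have exactly `Σᵢ n^{αᵢ}` variables, the complexity parameter for
`A`. For each `z̄ ∈ {1,…,n}^r`, we can look at `Φ(z̄)` as a boolean formula where we replace any occurrence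
of the relation `Rᵢ(z_{j₁},…,z_{j_{αᵢ}})` with the corresponding Boolean variable. Since each `Φ(z̄)`
depends on at most `k` variables, we can write each such formula in conjunctive normal form to get an
equivalent `k`-CNF." This file formalises that reduction (`SNPRed.redFn`, section `SNPRed`) for the
tree's vocabulary — `SNPFormula` (Mathlib first-order `BoundedFormula`, universal sentence), input tables
`R`, witness tables `W`, codes `encodingSNPInstance`, parameter `witnessBits n = Σᵢ n^{bᵢ}`; `kSATParam k`
(codes `encodingCNF`, parameter `CNF.numVars`):

* the Boolean variable of the witness atom `Sᵢ(ȳ)` is the POSITION of its bit among the witness table bits,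
  `tableOffset i + Σⱼ yⱼ nʲ < witnessBits n` (`SNPRed.keyIdx`), so `numVars ≤ witnessBits` and the parameter
  constant is `1`;
* `k := max A 3`, `A` the number of DISTINCT witness atoms of the quantifier-free matrix (a symbol with its
  argument variables; `SNPRed.atomList`); the CNF of `Φ(z̄)` is its truth table over the `2^A` masks `t`
  assigning values to these atoms — one clause "the atoms do not take the values `t`" per falsifying mask
  (`SNPRed.clauseOf`, `SNPRed.matrixClauses`, `SNPRed.clausesB`); a mask giving different values to two
  syntactically different atoms denoting the same bit under `z̄` yields a tautological clause, harmless
  (`SNPRed.forall_eval_clausesB_iff`: an assignment satisfies the CNF iff the formula holds with the witness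
  tables READ OFF the assignment, `SNPRed.tablesOfAssignment`);
* the string map is a brick assembly in the tree's algebra of `FP` functions over the evaluator toolkit of
  `ESOVerifier.lean` (decoding, unary numerics of `n`, assignments `codeL`, Horner positions `atomIdxFn`,
  table lookup `lookupFn`): the masked evaluator `SNPRed.evalWFn`, clause codes `SNPRed.clauseFn`, the
  matrix pieces `SNPRed.pieceFn`, and for each universal quantifier the CONCATENATION LOOP `catFn` over the
  `n` values of its variable (this file, the `++`-analogue of the `∧`-loop `allFn` of `ESOVerifier.lean`, in
  `FP` by `iterate_mem_FP_of_growth_poly` with pieces clipped to a size polynomial, `Brick.pclipF`); its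
  value on the code of `⟨n, R⟩` is the code of `SNPRed.cnfOf Φ R` (`SNPRed.redFn_codeOf`), non-codes go to
  the non-member `KSATRed.badCode`; correctness `SNPRed.satisfiable_cnfOf_iff`, width
  `SNPRed.isWidthLE_cnfOf`, parameter `SNPRed.numVars_cnfOf_le`; SERF packaging by `serfReducible_of_karp`
  (`SerfSNPInSNPProofs.lean`): `SNPRed.serfReducible_snp_kSATParam`.
* DEGENERATE input vocabularies (all input arities `0`): the code of `⟨n, R⟩` has length `O(log n)` while the
  CNF above has `n^r 2^A` clauses, so no polynomial-time map of this kind exists; but there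
  `Φ.language ∈ P` outright (`SNPFormula.language_mem_P_of_arities_eq_zero`, `SNPProofs.lean`, via
  preservation of universal sentences under substructures), and `P ⊆ SE` for every parameter
  (`mem_SE_of_lang_mem_P`). IPZ tacitly work with vocabularies containing a relation of positive arity.

## References

* R. Impagliazzo, R. Paturi, F. Zane, *Which problems have strongly exponential complexity?*,
  J. Comput. System Sci. 63 (2001) 512–530, §2.1 (SE, SERF, closure), §3, Thm. 3 and the theorem "every
  problem in SNP has a strong many-one reduction to `k`-SAT" preceding it. [ImpagliazzoPaturiZaneJCSS2001]
  Conference version: Proc. 39th FOCS (1998) 653–662, §3, Thm. 1, Thm. 2 [ImpagliazzoPaturiZaneFOCS1998]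
  (held as `paper:doi-10-1109-sfcs-1998-743516`, pp. 3, 6–7).
* L. Libkin, *Elements of Finite Model Theory*, Springer 2004, Prop. 6.6 (brute-force evaluation of
  first-order formulas, the pattern of `ESOVerifier.lean`).
* S. Arora, B. Barak, *Computational Complexity: A Modern Approach*, CUP 2009, §1.3, §1.4.1 (closure of
  polynomial time under composition and polynomially bounded loops).
-/

namespace Literature.Computability.FineGrained

open _root_.Computability Complexity Complexity.Brick Cryptography Polynomial
open Literature.ModelTheory.FiniteModelTheory

/-! ### Polynomial time is subexponential time for every parameter -/

/-- **`P ⊆ SE`**: if the language of a parameterised problem is decidable in polynomial time then the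
problem is in `SE` — the bound `c |x|^k + c ≤ 2c (|x|+1)^k ≤ c' · 2^{ε p(x)} · (|x|+1)^{c'}` for every
`ε > 0` and every parameter. [cite: ImpagliazzoPaturiZaneJCSS2001, §2 (definition of SE)] -/
theorem mem_SE_of_lang_mem_P {Q : ParamProblem} (h : Q.lang ∈ Classes.P) : Q ∈ SE := by
  obtain ⟨k, hk⟩ := Set.mem_iUnion.1 h
  obtain ⟨c, M, hM⟩ := hk
  intro ε hε
  refine ⟨fun a => c * a.length ^ k + c, M, ⟨2 * c + k, fun x => ?_⟩, hM⟩
  have hx0 : (0 : ℝ) ≤ (x.length : ℝ) := Nat.cast_nonneg _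
  have h1 : (1 : ℝ) ≤ (2 : ℝ) ^ (ε * (Q.param x : ℝ)) := Real.one_le_rpow one_le_two (by positivity)
  have h2 : ((x.length : ℝ)) ^ k ≤ ((x.length : ℝ) + 1) ^ (2 * c + k) := by
    calc ((x.length : ℝ)) ^ k ≤ ((x.length : ℝ) + 1) ^ k := by gcongr; linarith
      _ ≤ ((x.length : ℝ) + 1) ^ (2 * c + k) := pow_le_pow_right₀ (by linarith) (by omega)
  have h3 : (1 : ℝ) ≤ ((x.length : ℝ) + 1) ^ (2 * c + k) := one_le_pow₀ (by linarith)
  have h4 : ((c * x.length ^ k + c : ℕ) : ℝ) ≤ ((2 * c + k : ℕ) : ℝ) * ((x.length : ℝ) + 1) ^ (2 * c + k) := by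
    push_cast
    nlinarith
  calc (((fun a : List Bool => c * a.length ^ k + c) x : ℕ) : ℝ)
      = ((c * x.length ^ k + c : ℕ) : ℝ) := rfl
    _ ≤ ((2 * c + k : ℕ) : ℝ) * ((x.length : ℝ) + 1) ^ (2 * c + k) := h4
    _ = ((2 * c + k : ℕ) : ℝ) * 1 * ((x.length : ℝ) + 1) ^ (2 * c + k) := by ring
    _ ≤ ((2 * c + k : ℕ) : ℝ) * (2 : ℝ) ^ (ε * (Q.param x : ℝ)) * ((x.length : ℝ) + 1) ^ (2 * c + k) := by
      gcongr

/-! ### The concatenation loop of a first-order variable -/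

/-- The update of the concatenation loop on states `⟨z, ⟨as, ⟨c, acc⟩⟩⟩`: increment the counter and
append the piece `E ⟨z, snocFn l ⟨as, c⟩⟩` to the accumulator. [folklore] -/
noncomputable def catUpd (l : ℕ) (E : List Bool → List Bool) : List Bool → List Bool :=
  fanoutFn cvR (fanoutFn cvU (fanoutFn (addFn ∘ fanoutFn cvC (fun _ => encodeNat 1))
    (fun w => cvA w ++ E (mkArg l w))))

/-- One round of the concatenation loop: update while the counter is below the universe size.
[folklore] -/
noncomputable def catRound (l : ℕ) (E : List Bool → List Bool) : List Bool → List Bool :=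
  iteFn (ltFn ∘ fanoutFn cvC (uOf ∘ cvR)) (catUpd l E) id

/-- The initial state `⟨z, ⟨as, ⟨bin 0, ε⟩⟩⟩` of an argument word `⟨z, as⟩`. [folklore] -/
noncomputable def catInit : List Bool → List Bool :=
  fanoutFn zFn (fanoutFn asFn (fun _ => boolPair [] []))

/-- **THE CONCATENATION LOOP OF A FIRST-ORDER VARIABLE**: on `⟨z, as⟩`, `|z|` rounds of `catRound`,
then the accumulator — the concatenation of the pieces `E ⟨z, snocFn l ⟨as, bin a⟩⟩`, `a < n`
(`catFn_spec`). [cite: ImpagliazzoPaturiZaneJCSS2001, §3, proof of Thm. 3 (for each `z̄ ∈ {1,…,n}^r`)] -/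
noncomputable def catFn (l : ℕ) (E : List Bool → List Bool) : List Bool → List Bool :=
  cvA ∘ (fun w => (catRound l E)^[(X : Polynomial ℕ).eval (boolUnpair w).1.length] w) ∘ catInit

/-- `catUpd l E ∈ FP` for `E ∈ FP`. [folklore] -/
theorem catUpd_mem_FP (l : ℕ) {E : List Bool → List Bool} (hE : E ∈ FP) : catUpd l E ∈ FP :=
  fanoutFn_mem_FP cvR_mem_FP (fanoutFn_mem_FP cvU_mem_FP (fanoutFn_mem_FP
    (comp_mem_FP addFn_mem_FP (fanoutFn_mem_FP cvC_mem_FP (const_mem_FP _)))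
    (append_mem_FP cvA_mem_FP (comp_mem_FP hE (mkArg_mem_FP l)))))

/-- `catRound l E ∈ FP` for `E ∈ FP`. [folklore] -/
theorem catRound_mem_FP (l : ℕ) {E : List Bool → List Bool} (hE : E ∈ FP) : catRound l E ∈ FP :=
  iteFn_mem_FP (comp_mem_FP ltFn_mem_FP (fanoutFn_mem_FP cvC_mem_FP (comp_mem_FP uOf_mem_FP cvR_mem_FP)))
    (catUpd_mem_FP l hE) OracleCompose.id_mem_FP

/-- `catInit ∈ FP`. [folklore] -/
theorem catInit_mem_FP : catInit ∈ FP :=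
  fanoutFn_mem_FP zFn_mem_FP (fanoutFn_mem_FP asFn_mem_FP (const_mem_FP _))

/-- The loop condition is one-bit. [folklore] -/
theorem oneBit_catCond : OneBit (ltFn ∘ fanoutFn cvC (uOf ∘ cvR)) := oneBit_ltFn.comp _

/-- A round keeps the first field, on every input. [folklore] -/
theorem fst_catRound (l : ℕ) (E : List Bool → List Bool) (w : List Bool) :
    (boolUnpair (catRound l E w)).1 = (boolUnpair w).1 := by
  rw [catRound, iteFn_of_oneBit oneBit_catCond]
  split_ifs
  · simp [catUpd, fanoutFn_apply, cvR, fstP]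
  · rfl

/-- The first field of an argument word built by `mkArg` is the first field of the state. [folklore] -/
theorem fstP_mkArg (l : ℕ) (w : List Bool) : fstP (mkArg l w) = cvR w := by
  simp [mkArg, fanoutFn_apply]

/-- **Growth of a round, on every word**: the counter gains at most one bit and the accumulator gains
the piece, which has size `≤ G(|z|)` when `|E v| ≤ G(|fstP v|)` on every `v`. [folklore] -/
theorem length_catRound_le (l : ℕ) {E : List Bool → List Bool} {G : Polynomial ℕ}
    (hEG : ∀ v, (E v).length ≤ G.eval (fstP v).length) (w : List Bool) :
    (catRound l E w).length ≤ w.length + (G + 8 : Polynomial ℕ).eval (boolUnpair w).1.length := by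
  rw [catRound, iteFn_of_oneBit oneBit_catCond]
  split_ifs
  · simp only [catUpd, fanoutFn_apply, Function.comp_apply, length_boolPair, addFn_boolPair, bitsToNat_encodeNat,
      List.length_append, eval_add]
    have h0 := OracleCompose.length_boolUnpair_le w
    have h1 := OracleCompose.length_boolUnpair_le (boolUnpair w).2
    have h2 := OracleCompose.length_boolUnpair_le (boolUnpair (boolUnpair w).2).2
    have h3 : (encodeNat (bitsToNat (cvC w) + 1)).length ≤ (cvC w).length + 1 :=
      (length_encodeNat_succ_le _).trans (Nat.succ_le_succ (length_encodeNat_bitsToNat_le _))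
    have h4 : (E (mkArg l w)).length ≤ G.eval (cvR w).length := by
      have := hEG (mkArg l w); rwa [fstP_mkArg] at this
    have h8 : (8 : Polynomial ℕ).eval (boolUnpair w).1.length = 8 := by
      rw [show (8 : Polynomial ℕ) = Polynomial.C 8 from rfl, eval_C]
    simp only [cvR, cvU, cvC, cvA, fstP, sndP, Function.comp_apply] at *
    omega
  · simp

/-- **`catFn l E ∈ FP`** for `E ∈ FP` of polynomially bounded output in its first field (e.g. a clipped
function, `length_pclipF_le`). [cite: AroraBarak2009, §1.3 (bounded loops), §1.4.1] -/
theorem catFn_mem_FP (l : ℕ) {E : List Bool → List Bool} (hE : E ∈ FP) {G : Polynomial ℕ}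
    (hEG : ∀ v, (E v).length ≤ G.eval (fstP v).length) : catFn l E ∈ FP :=
  comp_mem_FP cvA_mem_FP (comp_mem_FP
    (iterate_mem_FP_of_growth_poly (catRound_mem_FP l hE) (G + 8) (fst_catRound l E) (length_catRound_le l hEG) X)
    catInit_mem_FP)

/-- `catFn l (pclipF G E) ∈ FP` for `E ∈ FP`. [folklore] -/
theorem catFn_pclipF_mem_FP (l : ℕ) (G : Polynomial ℕ) {E : List Bool → List Bool} (hE : E ∈ FP) :
    catFn l (pclipF G E) ∈ FP :=
  catFn_mem_FP l (pclipF_mem_FP G hE) (length_pclipF_le G E)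

/-- One round on a loop state with counter `bin m`. [folklore] -/
theorem catRound_state (l : ℕ) (E : List Bool → List Bool) (z as : List Bool) (m : ℕ) (acc : List Bool) :
    catRound l E (boolPair z (boolPair as (boolPair (encodeNat m) acc))) =
      if m < nOf z then boolPair z (boolPair as (boolPair (encodeNat (m + 1))
        (acc ++ E (boolPair z (snocFn l (boolPair as (encodeNat m)))))))
      else boolPair z (boolPair as (boolPair (encodeNat m) acc)) := by
  have hc : (ltFn ∘ fanoutFn cvC (uOf ∘ cvR)) (boolPair z (boolPair as (boolPair (encodeNat m) acc))) =
      [decide (m < nOf z)] := by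
    simp [fanoutFn_apply, cvC, cvR, fstP, sndP, nOf, uOf]
  unfold catRound
  rw [iteFn_apply hc]
  by_cases h : m < nOf z
  · rw [decide_eq_true h, if_pos rfl, if_pos h]
    simp [catUpd, mkArg, fanoutFn_apply, cvR, cvU, cvC, cvA, fstP, sndP, bitsToNat_encodeNat]
  · rw [decide_eq_false h, if_neg h]
    simp

/-- The pieces `E ⟨z, snocFn l ⟨as, bin a⟩⟩` for `a = m, …, m + j - 1`, concatenated. [folklore] -/
noncomputable def catPieces (l : ℕ) (E : List Bool → List Bool) (z as : List Bool) (m j : ℕ) : List Bool :=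
  ((List.range j).map fun i => E (boolPair z (snocFn l (boolPair as (encodeNat (m + i)))))).flatten

/-- No pieces. [folklore] -/
@[simp] theorem catPieces_zero (l : ℕ) (E : List Bool → List Bool) (z as : List Bool) (m : ℕ) :
    catPieces l E z as m 0 = [] := by simp [catPieces]

/-- One more piece at the back. [folklore] -/
theorem catPieces_succ (l : ℕ) (E : List Bool → List Bool) (z as : List Bool) (m j : ℕ) :
    catPieces l E z as m (j + 1) =
      catPieces l E z as m j ++ E (boolPair z (snocFn l (boolPair as (encodeNat (m + j))))) := by
  simp [catPieces, List.range_succ]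

/-- One more piece at the front. [folklore] -/
theorem catPieces_succ' (l : ℕ) (E : List Bool → List Bool) (z as : List Bool) (m j : ℕ) :
    catPieces l E z as m (j + 1) =
      E (boolPair z (snocFn l (boolPair as (encodeNat m)))) ++ catPieces l E z as (m + 1) j := by
  induction j with
  | zero => simp [catPieces]
  | succ j ih =>
    rw [catPieces_succ, ih, List.append_assoc, catPieces_succ l E z as (m + 1) j,
      show m + 1 + j = m + (j + 1) by omega]

/-- The loop invariant: from counter `bin m` (`m ≤ n`), `k` rounds reach counter `bin (min (m+k) n)` and
append the pieces `m, …, min (m+k) n - 1`. [folklore] -/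
theorem iterate_catRound (l : ℕ) (E : List Bool → List Bool) (z as : List Bool) :
    ∀ (k m : ℕ), m ≤ nOf z → ∀ acc : List Bool,
      (catRound l E)^[k] (boolPair z (boolPair as (boolPair (encodeNat m) acc))) =
        boolPair z (boolPair as (boolPair (encodeNat (min (m + k) (nOf z)))
          (acc ++ catPieces l E z as m (min (m + k) (nOf z) - m))))
  | 0, m, hm, acc => by simp [Nat.min_eq_left hm]
  | k + 1, m, hm, acc => by
    rw [Function.iterate_succ_apply, catRound_state]
    by_cases h : m < nOf z
    · rw [if_pos h, iterate_catRound l E z as k (m + 1) h, List.append_assoc, ← catPieces_succ',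
        show m + 1 + k = m + (k + 1) by ring]
      congr 4
      have : min (m + (k + 1)) (nOf z) - m = (min (m + (k + 1)) (nOf z) - (m + 1)) + 1 := by omega
      rw [this]
    · have hm' : m = nOf z := le_antisymm hm (not_lt.1 h)
      rw [if_neg h, iterate_catRound l E z as k m hm]
      subst hm'
      simp

/-- **Specification of the concatenation loop**: on `⟨z, as⟩` (rounds `|z| ≥ n`), the value is the
concatenation over `a < n`, in increasing order, of the pieces `E ⟨z, snocFn l ⟨as, bin a⟩⟩`.
[cite: ImpagliazzoPaturiZaneJCSS2001, §3, proof of Thm. 3] -/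
theorem catFn_spec (l : ℕ) (E : List Bool → List Bool) (z as : List Bool) (hz : nOf z ≤ z.length) :
    catFn l E (boolPair z as) = catPieces l E z as 0 (nOf z) := by
  have h0 : catInit (boolPair z as) = boolPair z (boolPair as (boolPair (encodeNat 0) [])) := by
    rw [catInit, fanoutFn_apply, fanoutFn_apply, show zFn (boolPair z as) = z from fstP_boolPair _ _,
      show asFn (boolPair z as) = as from sndP_boolPair _ _]
    rfl
  simp only [catFn, Function.comp_apply, h0, boolUnpair_boolPair, eval_X]
  rw [iterate_catRound l E z as _ 0 (Nat.zero_le _), Nat.zero_add, Nat.min_eq_right hz]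
  simp [cvA, sndP]

/-- The pieces through the `snocFn`/`codeL` bookkeeping: on an assignment code `codeL vs` with
`|vs| = l`, piece `a` is `E ⟨z, codeL (vs ++ [a])⟩`. [folklore] -/
theorem catPieces_codeL (l : ℕ) (E : List Bool → List Bool) (z : List Bool) (vs : List ℕ) (hl : vs.length = l)
    (m j : ℕ) :
    catPieces l E z (codeL vs) m j = ((List.range j).map fun i => E (boolPair z (codeL (vs ++ [m + i])))).flatten := by
  unfold catPieces
  congr 1
  refine List.map_congr_left fun i _ => ?_
  rw [snocFn_spec l vs hl, codeLsnoc_encodeNat]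

namespace SNPRed

variable {ar wit : List ℕ}

/-! ### Witness atoms of a formula -/

/-- The KEY of a witness atom occurrence `Sᵢ(x_{j₁}, …, x_{j_b})`: the symbol `i` and the argument
variables `[j₁, …, j_b]`. [folklore] -/
abbrev Key (wit : List ℕ) : Type := Fin wit.length × List ℕ

/-- The keys of the witness atom occurrences of a formula, in reading order, with repetitions
(quantified subformulas contribute nothing: only the atoms of a quantifier-free matrix are used). [folklore] -/
def watoms : ∀ {l : ℕ}, ((relLanguage ar).sum (relLanguage wit)).BoundedFormula Empty l → List (Key wit)
  | _, FirstOrder.Language.BoundedFormula.falsum => []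
  | _, FirstOrder.Language.BoundedFormula.equal _ _ => []
  | _, FirstOrder.Language.BoundedFormula.rel (Sum.inl _) _ => []
  | _, FirstOrder.Language.BoundedFormula.rel (Sum.inr r) ts => [(r.1, witArgs r ts)]
  | _, FirstOrder.Language.BoundedFormula.imp f₁ f₂ => watoms f₁ ++ watoms f₂
  | _, FirstOrder.Language.BoundedFormula.all _ => []

/-- The DISTINCT witness atoms of a formula ("the number of occurrences of the relation symbols",
counted without repetition). [cite: ImpagliazzoPaturiZaneJCSS2001, §3, proof of Thm. 3] -/
def atomList {l : ℕ} (ψ : ((relLanguage ar).sum (relLanguage wit)).BoundedFormula Empty l) : List (Key wit) :=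
  (watoms ψ).dedup

/-- The atom list has no duplicates. [folklore] -/
theorem nodup_atomList {l : ℕ} (ψ : ((relLanguage ar).sum (relLanguage wit)).BoundedFormula Empty l) :
    (atomList ψ).Nodup :=
  List.nodup_dedup _

/-- Every witness atom occurrence is in the atom list. [folklore] -/
theorem mem_atomList_iff {l : ℕ} (ψ : ((relLanguage ar).sum (relLanguage wit)).BoundedFormula Empty l)
    (κ : Key wit) : κ ∈ atomList ψ ↔ κ ∈ watoms ψ :=
  List.mem_dedup

/-! ### Boolean evaluation of the matrix with prescribed witness atom values -/

/-- The value of an assignment of values to (positions of) atoms at a key: bit `idxOf κ` of the mask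
`t`. [folklore] -/
def maskVal (atoms : List (Key wit)) (t : ℕ) (κ : Key wit) : Bool := t.testBit (atoms.idxOf κ)

/-- **Boolean evaluation of a formula** on input tables `R`, at the assignment `vs` of its free
(bound-above) variables, with every WITNESS atom occurrence replaced by the bit the mask `t` assigns to
its key ("replace any occurrence of the relation `Rᵢ(z_{j₁},…)` with the corresponding Boolean
variable", then evaluate at a truth assignment of these variables). Quantified subformulas evaluate
to `false` (the matrix is quantifier-free). [cite: ImpagliazzoPaturiZaneJCSS2001, §3, proof of Thm. 3] -/
def evalB {n : ℕ} (R : RelTables ar n) (atoms : List (Key wit)) (t : ℕ) (vs : List ℕ) :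
    ∀ {l : ℕ}, ((relLanguage ar).sum (relLanguage wit)).BoundedFormula Empty l → Bool
  | _, FirstOrder.Language.BoundedFormula.falsum => false
  | _, FirstOrder.Language.BoundedFormula.equal t₁ t₂ => decide (vs.getD (termVar t₁) 0 = vs.getD (termVar t₂) 0)
  | _, FirstOrder.Language.BoundedFormula.rel (Sum.inl r) ts =>
      if h : ∀ j : Fin (ar.get r.1), vs.getD (termVar (ts (Fin.cast r.2 j))) 0 < n then
        R r.1 fun j => ⟨vs.getD (termVar (ts (Fin.cast r.2 j))) 0, h j⟩
      else false
  | _, FirstOrder.Language.BoundedFormula.rel (Sum.inr r) ts => maskVal atoms t (r.1, witArgs r ts)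
  | _, FirstOrder.Language.BoundedFormula.imp f₁ f₂ => !(evalB R atoms t vs f₁) || evalB R atoms t vs f₂
  | _, FirstOrder.Language.BoundedFormula.all _ => false

/-- **THE EVALUATOR WITH MASKED WITNESS ATOMS**, as a string function on argument words
`⟨z, assignment⟩` (the `evalFn` of `ESOVerifier.lean` with the witness lookup replaced by the constant
bit of the mask). [cite: ImpagliazzoPaturiZaneJCSS2001, §3, proof of Thm. 3] -/
noncomputable def evalWFn (atoms : List (Key wit)) (t : ℕ) :
    ∀ {l : ℕ}, ((relLanguage ar).sum (relLanguage wit)).BoundedFormula Empty l → (List Bool → List Bool)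
  | _, FirstOrder.Language.BoundedFormula.falsum => fun _ => [false]
  | _, FirstOrder.Language.BoundedFormula.equal t₁ t₂ =>
      eqPairFn ∘ fanoutFn (varValFn (termVar t₁)) (varValFn (termVar t₂))
  | _, FirstOrder.Language.BoundedFormula.rel (Sum.inl r) ts => lookupFn tOf ar r.1 (inArgs r ts)
  | _, FirstOrder.Language.BoundedFormula.rel (Sum.inr r) ts => fun _ => [maskVal atoms t (r.1, witArgs r ts)]
  | _, FirstOrder.Language.BoundedFormula.imp f₁ f₂ =>
      iteFn (evalWFn atoms t f₁) (evalWFn atoms t f₂) (fun _ => [true])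
  | _, FirstOrder.Language.BoundedFormula.all _ => fun _ => [false]

/-- **The masked evaluator is polynomial time.** [cite: AroraBarak2009, §1.3] -/
theorem evalWFn_mem_FP (atoms : List (Key wit)) (t : ℕ) :
    ∀ {l : ℕ} (φ : ((relLanguage ar).sum (relLanguage wit)).BoundedFormula Empty l), evalWFn atoms t φ ∈ FP
  | _, FirstOrder.Language.BoundedFormula.falsum => by rw [evalWFn]; exact const_mem_FP _
  | _, FirstOrder.Language.BoundedFormula.equal t₁ t₂ => by
    rw [evalWFn]; exact comp_mem_FP eqPairFn_mem_FP (fanoutFn_mem_FP (varValFn_mem_FP _) (varValFn_mem_FP _))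
  | _, FirstOrder.Language.BoundedFormula.rel (Sum.inl r) ts => by rw [evalWFn]; exact lookupFn_mem_FP tOf_mem_FP _ _ _
  | _, FirstOrder.Language.BoundedFormula.rel (Sum.inr r) ts => by rw [evalWFn]; exact const_mem_FP _
  | _, FirstOrder.Language.BoundedFormula.imp f₁ f₂ => by
    rw [evalWFn]; exact iteFn_mem_FP (evalWFn_mem_FP atoms t f₁) (evalWFn_mem_FP atoms t f₂) (const_mem_FP _)
  | _, FirstOrder.Language.BoundedFormula.all f => by rw [evalWFn]; exact const_mem_FP _

/-! ### Correctness of the masked evaluator -/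

section Spec

open scoped Classical

variable {n : ℕ} (R : RelTables ar n)

/-- The genuine instance words: `z = ⟨code of ⟨n, R⟩, ε⟩` (the argument layout of `ESOVerifier.lean`
with no witness tables). [folklore] -/
def zOf (R : RelTables ar n) : List Bool := boolPair (codeOf R) []

/-- Decoding a genuine instance word. [folklore] -/
theorem decode_zOf : uOf (zOf R) = encodeNat n ∧ tOf (zOf R) = List.ofFn (relTablesEquiv ar n R) ∧
    nOf (zOf R) = n := by
  simp [zOf, uOf, tOf, nOf, fstP, sndP, codeOf_eq]

/-- Under non-degeneracy, `n ≤ |zOf R|`. [folklore] -/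
theorem n_le_length_zOf (har : IsNondegenerateVocab ar) : n ≤ (zOf R).length := by
  rw [zOf, length_boolPair, length_codeOf]
  have := le_tableBits_of_isNondegenerateVocab har n
  omega

variable {R}

/-- **Correctness of the masked evaluator**: on an argument word `⟨zOf R, codeL vs⟩` with `n ≤ |zOf R|`
it returns the bit `evalB`. [cite: ImpagliazzoPaturiZaneJCSS2001, §3, proof of Thm. 3] -/
theorem evalWFn_spec (hz : n ≤ (zOf R).length) (atoms : List (Key wit)) (t : ℕ) :
    ∀ {l : ℕ} (φ : ((relLanguage ar).sum (relLanguage wit)).BoundedFormula Empty l)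
      (vs : List ℕ) (_hl : vs.length = l) (_hvs : ∀ x ∈ vs, x < n),
      evalWFn atoms t φ (boolPair (zOf R) (codeL vs)) = [evalB R atoms t vs φ] := by
  obtain ⟨huz, htz, hnz⟩ := decode_zOf R
  have hz' : nOf (zOf R) ≤ (zOf R).length := by rw [hnz]; exact hz
  intro l φ
  induction φ with
  | falsum => intro vs hl hvs; rw [evalWFn]; rfl
  | equal t₁ t₂ =>
    intro vs hl hvs
    rw [evalWFn]
    have h1 := termVar_lt t₁; have h2 := termVar_lt t₂
    have h1' : termVar t₁ < vs.length := by omega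
    have h2' : termVar t₂ < vs.length := by omega
    simp only [Function.comp_apply, fanoutFn_apply, varValFn_arg (zOf R) vs h1', varValFn_arg (zOf R) vs h2',
      eqPairFn_boolPair, evalB, List.getD_eq_getElem _ _ h1', List.getD_eq_getElem _ _ h2']
    congr 1
    rw [decide_eq_decide]
    exact encodeNat_inj
  | rel Rs ts =>
    intro vs hl hvs
    rcases Rs with ⟨s, hs⟩ | ⟨s, hs⟩
    · rw [evalWFn]
      have hargs : ∀ j : Fin (ar.get s), termVar (ts (Fin.cast hs j)) < vs.length := fun j => by
        rw [hl]; exact termVar_lt _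
      rw [show inArgs ⟨s, hs⟩ ts = List.ofFn (fun j : Fin (ar.get s) => termVar (ts (Fin.cast hs j))) from rfl,
        lookupFn_spec R tOf (zOf R) hnz hz' htz vs hvs s _ hargs]
      have hlt : ∀ j : Fin (ar.get s), vs.getD (termVar (ts (Fin.cast hs j))) 0 < n := fun j => by
        rw [List.getD_eq_getElem _ _ (hargs j)]; exact hvs _ (List.getElem_mem _)
      simp only [evalB, dif_pos hlt]
      congr 2
      funext j
      exact Fin.ext (List.getD_eq_getElem _ _ (hargs j)).symm
    · rw [evalWFn]; rfl
  | imp f₁ f₂ ih₁ ih₂ =>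
    intro vs hl hvs
    rw [evalWFn, iteFn_apply (ih₁ vs hl hvs), evalB]
    cases evalB R atoms t vs f₁
    · rfl
    · simp [ih₂ vs hl hvs]
  | all f ih => intro vs hl hvs; rw [evalWFn]; rfl

variable (W : RelTables wit n)

/-- The value of a witness key `(s, args)` under the witness tables `W` at the assignment `vs`: the
bit `W s (vs[args₀], …)` (and `false` if an argument is out of range). [folklore] -/
def keyVal (vs : List ℕ) (κ : Key wit) : Bool :=
  if h : ∀ j : Fin (wit.get κ.1), vs.getD (κ.2.getD j 0) 0 < n then
    W κ.1 fun j => ⟨vs.getD (κ.2.getD j 0) 0, h j⟩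
  else false

variable {W}

/-- **Agreement lemma**: if the mask gives every witness atom of a QUANTIFIER-FREE formula its value
under `W` at `vs`, then `evalB` is the truth value of the formula in `(R, W)` at `vs`.
[cite: ImpagliazzoPaturiZaneJCSS2001, §3, proof of Thm. 3 ("replace any occurrence of the relation … with
the corresponding Boolean variable")] -/
theorem evalB_eq_decide_realizesB (atoms : List (Key wit)) (t : ℕ) {l : ℕ}
    {φ : ((relLanguage ar).sum (relLanguage wit)).BoundedFormula Empty l} (hφ : φ.IsQF)
    (vs : List ℕ) (hl : vs.length = l) (hvs : ∀ x ∈ vs, x < n)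
    (hag : ∀ κ ∈ watoms φ, maskVal atoms t κ = keyVal W vs κ) :
    evalB R atoms t vs φ = decide (RealizesB R W φ (xsOf vs hl hvs)) := by
  letI := @FirstOrder.Language.sumStructure _ _ (Fin n) (structureOfTables R) (structureOfTables W)
  induction hφ with
  | falsum => simp [evalB, RealizesB, FirstOrder.Language.BoundedFormula.Realize]
  | of_isAtomic h =>
    cases h with
    | equal t₁ t₂ =>
      have h1 := termVar_lt t₁; have h2 := termVar_lt t₂
      have h1' : termVar t₁ < vs.length := by omega
      have h2' : termVar t₂ < vs.length := by omega
      change decide (vs.getD (termVar t₁) 0 = vs.getD (termVar t₂) 0) = _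
      rw [List.getD_eq_getElem _ _ h1', List.getD_eq_getElem _ _ h2', decide_eq_decide]
      unfold RealizesB
      simp only [FirstOrder.Language.Term.bdEqual, FirstOrder.Language.BoundedFormula.Realize,
        realize_term_eq t₁ _ h1, realize_term_eq t₂ _ h2, xsOf, Fin.mk.injEq]
    | rel Rs ts =>
      rcases Rs with ⟨s, hs⟩ | ⟨s, hs⟩
      · have hargs : ∀ j : Fin (ar.get s), termVar (ts (Fin.cast hs j)) < vs.length := fun j => by
          rw [hl]; exact termVar_lt _
        have hlt : ∀ j : Fin (ar.get s), vs.getD (termVar (ts (Fin.cast hs j))) 0 < n := fun j => by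
          rw [List.getD_eq_getElem _ _ (hargs j)]; exact hvs _ (List.getElem_mem _)
        change (if h : ∀ j : Fin (ar.get s), vs.getD (termVar (ts (Fin.cast hs j))) 0 < n then
            R s fun j => ⟨vs.getD (termVar (ts (Fin.cast hs j))) 0, h j⟩ else false) = _
        rw [dif_pos hlt]
        symm
        rw [← Bool.decide_eq_true (b := R s fun j => ⟨vs.getD (termVar (ts (Fin.cast hs j))) 0, hlt j⟩)]
        refine decide_eq_decide.2 ?_
        unfold RealizesB
        show (R s ((fun i => FirstOrder.Language.Term.realize (Sum.elim default (xsOf vs hl hvs)) (ts i)) ∘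
          Fin.cast hs) = true) ↔ _
        rw [show ((fun i => FirstOrder.Language.Term.realize (Sum.elim default (xsOf vs hl hvs)) (ts i)) ∘ Fin.cast hs) =
          (fun j => ⟨vs.getD (termVar (ts (Fin.cast hs j))) 0, hlt j⟩) from funext fun j => by
            simp only [Function.comp_apply]
            rw [realize_term_eq (ts (Fin.cast hs j)) _ (termVar_lt _)]
            exact Fin.ext (List.getD_eq_getElem _ _ (hargs j)).symm]
      · have hargs : ∀ j : Fin (wit.get s), termVar (ts (Fin.cast hs j)) < vs.length := fun j => by
          rw [hl]; exact termVar_lt _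
        have hw : ∀ j : Fin (wit.get s), (witArgs ⟨s, hs⟩ ts).getD j 0 = termVar (ts (Fin.cast hs j)) := fun j => by
          unfold witArgs
          rw [List.getD_eq_getElem _ _ (by simp), List.getElem_ofFn]
        have hlt : ∀ j : Fin (wit.get s), vs.getD ((witArgs ⟨s, hs⟩ ts).getD j 0) 0 < n := fun j => by
          rw [hw j, List.getD_eq_getElem _ _ (hargs j)]
          exact hvs _ (List.getElem_mem _)
        have hkey : ((⟨s, hs⟩ : (relLanguage wit).Relations _).1, witArgs ⟨s, hs⟩ ts) ∈
            watoms (FirstOrder.Language.BoundedFormula.rel (Sum.inr ⟨s, hs⟩) ts :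
              ((relLanguage ar).sum (relLanguage wit)).BoundedFormula Empty _) := by
          rw [watoms]; exact List.mem_singleton_self _
        change maskVal atoms t ((⟨s, hs⟩ : (relLanguage wit).Relations _).1, witArgs ⟨s, hs⟩ ts) = _
        rw [hag _ hkey, keyVal, dif_pos hlt]
        symm
        rw [← Bool.decide_eq_true (b := W s fun j => ⟨vs.getD ((witArgs ⟨s, hs⟩ ts).getD j 0) 0, hlt j⟩)]
        refine decide_eq_decide.2 ?_
        unfold RealizesB
        show (W s ((fun i => FirstOrder.Language.Term.realize (Sum.elim default (xsOf vs hl hvs)) (ts i)) ∘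
          Fin.cast hs) = true) ↔ _
        rw [show ((fun i => FirstOrder.Language.Term.realize (Sum.elim default (xsOf vs hl hvs)) (ts i)) ∘ Fin.cast hs) =
          (fun j => ⟨vs.getD ((witArgs ⟨s, hs⟩ ts).getD j 0) 0, hlt j⟩) from funext fun j => by
            simp only [Function.comp_apply]
            rw [realize_term_eq (ts (Fin.cast hs j)) _ (termVar_lt _)]
            apply Fin.ext
            simp only [xsOf]
            rw [hw j, List.getD_eq_getElem _ _ (hargs j)]]
  | @imp φ₁ φ₂ h₁ h₂ ih₁ ih₂ =>
    have hag₁ : ∀ κ ∈ watoms φ₁, maskVal atoms t κ = keyVal W vs κ := fun κ hκ => hag κ (by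
      rw [watoms]; exact List.mem_append_left _ hκ)
    have hag₂ : ∀ κ ∈ watoms φ₂, maskVal atoms t κ = keyVal W vs κ := fun κ hκ => hag κ (by
      rw [watoms]; exact List.mem_append_right _ hκ)
    rw [evalB, ih₁ hag₁, ih₂ hag₂]
    have e : RealizesB R W (φ₁.imp φ₂) (xsOf vs hl hvs) ↔
        (RealizesB R W φ₁ (xsOf vs hl hvs) → RealizesB R W φ₂ (xsOf vs hl hvs)) := Iff.rfl
    by_cases hr₁ : RealizesB R W φ₁ (xsOf vs hl hvs) <;> by_cases hr₂ : RealizesB R W φ₂ (xsOf vs hl hvs) <;>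
      simp [e, hr₁, hr₂]

end Spec

/-! ### The clause excluding a mask, at an assignment -/

/-- The Boolean VARIABLE of a witness key at the assignment `vs`: the position of the bit `Sᵢ(ȳ)` among
the witness table bits, `tableOffset i + Σⱼ yⱼ nʲ` ("introduce a variable `x_{i,ȳ}` representing
whether `Rᵢ(ȳ)` is true … exactly `Σᵢ n^{αᵢ}` variables"). [cite: ImpagliazzoPaturiZaneJCSS2001, §3, proof of Thm. 3] -/
def keyIdx (n : ℕ) (vs : List ℕ) (κ : Key wit) : ℕ := tableOffset wit n κ.1 + hval n vs κ.2

/-- The literals "atom `κⱼ` does not take the value `t ⱼ`" for the keys from position `j` on. [folklore] -/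
def litsOf (n : ℕ) (vs : List ℕ) (t : ℕ) : List (Key wit) → ℕ → Clause ℕ
  | [], _ => []
  | κ :: rest, j => (keyIdx n vs κ, !t.testBit j) :: litsOf n vs t rest (j + 1)

/-- **The clause excluding the mask `t`** at the assignment `vs`: "the atoms do not take the values `t`".
[cite: ImpagliazzoPaturiZaneJCSS2001, §3, proof of Thm. 3 ("write each such formula in conjunctive normal form")] -/
def clauseOf (atoms : List (Key wit)) (n : ℕ) (vs : List ℕ) (t : ℕ) : Clause ℕ := litsOf n vs t atoms 0

/-- The number of literals. [folklore] -/
theorem length_litsOf (n : ℕ) (vs : List ℕ) (t : ℕ) : ∀ (keys : List (Key wit)) (j : ℕ),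
    (litsOf n vs t keys j).length = keys.length
  | [], _ => rfl
  | κ :: rest, j => by rw [litsOf, List.length_cons, length_litsOf n vs t rest (j + 1), List.length_cons]

/-- The literals, by position. [folklore] -/
theorem getElem_litsOf (n : ℕ) (vs : List ℕ) (t : ℕ) : ∀ (keys : List (Key wit)) (j i : ℕ)
    (hi : i < (litsOf n vs t keys j).length),
    (litsOf n vs t keys j)[i] = (keyIdx n vs (keys[i]'(by rwa [length_litsOf] at hi)), !t.testBit (j + i))
  | [], _, i, hi => by simp [litsOf] at hi
  | κ :: rest, j, 0, hi => by simp [litsOf]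
  | κ :: rest, j, i + 1, hi => by
    simp only [litsOf, List.getElem_cons_succ]
    rw [getElem_litsOf n vs t rest (j + 1) i, show j + 1 + i = j + (i + 1) by omega]

/-- Membership in the literal list. [folklore] -/
theorem mem_litsOf_iff (n : ℕ) (vs : List ℕ) (t : ℕ) (keys : List (Key wit)) (j : ℕ) (lit : Literal ℕ) :
    lit ∈ litsOf n vs t keys j ↔ ∃ i : ℕ, ∃ hi : i < keys.length, lit = (keyIdx n vs keys[i], !t.testBit (j + i)) := by
  rw [List.mem_iff_getElem]
  constructor
  · rintro ⟨i, hi, rfl⟩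
    exact ⟨i, by rwa [length_litsOf] at hi, getElem_litsOf n vs t keys j i hi⟩
  · rintro ⟨i, hi, rfl⟩
    exact ⟨i, by rwa [length_litsOf], getElem_litsOf n vs t keys j i _⟩

/-- The code of the literal "key `κ` has polarity `b`": the binary numeral of the unary position
`atomIdxFn`, paired with the bit. [folklore] -/
noncomputable def litFn (κ : Key wit) (b : Bool) : List Bool → List Bool :=
  fanoutFn (lenBinF ∘ atomIdxFn wit κ.1 κ.2) (fun _ => [b])

/-- `litFn κ b ∈ FP`. [folklore] -/
theorem litFn_mem_FP (κ : Key wit) (b : Bool) : litFn κ b ∈ FP :=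
  fanoutFn_mem_FP (comp_mem_FP lenBinF_mem_FP (atomIdxFn_mem_FP wit κ.1 κ.2)) (const_mem_FP _)

/-- The list code of the literal codes, from mask position `j` on. [folklore] -/
noncomputable def litsFn (t : ℕ) : List (Key wit) → ℕ → (List Bool → List Bool)
  | [], _ => fun _ => []
  | κ :: rest, j => fanoutFn (litFn κ (!t.testBit j)) (litsFn t rest (j + 1))

/-- `litsFn t keys j ∈ FP`. [folklore] -/
theorem litsFn_mem_FP (t : ℕ) : ∀ (keys : List (Key wit)) (j : ℕ), litsFn t keys j ∈ FP
  | [], _ => const_mem_FP _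
  | κ :: rest, j => fanoutFn_mem_FP (litFn_mem_FP κ _) (litsFn_mem_FP t rest (j + 1))

/-- **The code of the clause excluding the mask `t`.** [cite: ImpagliazzoPaturiZaneJCSS2001, §3, proof of Thm. 3] -/
noncomputable def clauseFn (atoms : List (Key wit)) (t : ℕ) : List Bool → List Bool :=
  fanoutFn (fun _ => unaryEncodeNat atoms.length) (litsFn t atoms 0)

/-- `clauseFn atoms t ∈ FP`. [folklore] -/
theorem clauseFn_mem_FP (atoms : List (Key wit)) (t : ℕ) : clauseFn atoms t ∈ FP :=
  fanoutFn_mem_FP (const_mem_FP _) (litsFn_mem_FP t atoms 0)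

/-! ### The pieces of the matrix: one (framed) clause per falsifying mask -/

/-- Finite concatenation of the string functions `p 0, …, p (T-1)`. [folklore] -/
noncomputable def catT : ℕ → (ℕ → (List Bool → List Bool)) → (List Bool → List Bool)
  | 0, _ => fun _ => []
  | T + 1, p => fun v => catT T p v ++ p T v

/-- `catT T p ∈ FP` for pieces in `FP`. [folklore] -/
theorem catT_mem_FP : ∀ (T : ℕ) {p : ℕ → (List Bool → List Bool)}, (∀ t, p t ∈ FP) → catT T p ∈ FP
  | 0, _, _ => const_mem_FP _
  | T + 1, _, hp => append_mem_FP (catT_mem_FP T hp) (hp T)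

/-- Value of the finite concatenation. [folklore] -/
theorem catT_apply (p : ℕ → (List Bool → List Bool)) (v : List Bool) :
    ∀ T : ℕ, catT T p v = ((List.range T).map fun t => p t v).flatten
  | 0 => rfl
  | T + 1 => by
    show catT T p v ++ p T v = _
    rw [catT_apply p v T, List.range_succ]; simp

/-- The body piece of mask `t`: nothing if the matrix is true under `t`, else the framed clause code
(`boolPair c ε`, one item of a list code). [cite: ImpagliazzoPaturiZaneJCSS2001, §3, proof of Thm. 3] -/
noncomputable def pieceFn (atoms : List (Key wit)) {l : ℕ}
    (ψ : ((relLanguage ar).sum (relLanguage wit)).BoundedFormula Empty l) (t : ℕ) : List Bool → List Bool :=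
  iteFn (evalWFn atoms t ψ) (fun _ => []) (fanoutFn (clauseFn atoms t) (fun _ => []))

/-- The count piece of mask `t`: nothing if the matrix is true under `t`, else one tally mark. [folklore] -/
noncomputable def cntPieceFn (atoms : List (Key wit)) {l : ℕ}
    (ψ : ((relLanguage ar).sum (relLanguage wit)).BoundedFormula Empty l) (t : ℕ) : List Bool → List Bool :=
  iteFn (evalWFn atoms t ψ) (fun _ => []) (fun _ => [true])

/-- `pieceFn atoms ψ t ∈ FP`. [folklore] -/
theorem pieceFn_mem_FP (atoms : List (Key wit)) {l : ℕ}
    (ψ : ((relLanguage ar).sum (relLanguage wit)).BoundedFormula Empty l) (t : ℕ) : pieceFn atoms ψ t ∈ FP :=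
  iteFn_mem_FP (evalWFn_mem_FP atoms t ψ) (const_mem_FP _) (fanoutFn_mem_FP (clauseFn_mem_FP atoms t) (const_mem_FP _))

/-- `cntPieceFn atoms ψ t ∈ FP`. [folklore] -/
theorem cntPieceFn_mem_FP (atoms : List (Key wit)) {l : ℕ}
    (ψ : ((relLanguage ar).sum (relLanguage wit)).BoundedFormula Empty l) (t : ℕ) : cntPieceFn atoms ψ t ∈ FP :=
  iteFn_mem_FP (evalWFn_mem_FP atoms t ψ) (const_mem_FP _) (const_mem_FP _)

/-- **The list code of the truth-table CNF of the matrix** at an assignment: the framed clause codes of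
the falsifying masks `t < 2^A`. [cite: ImpagliazzoPaturiZaneJCSS2001, §3, proof of Thm. 3] -/
noncomputable def matrixBodyFn {l : ℕ} (ψ : ((relLanguage ar).sum (relLanguage wit)).BoundedFormula Empty l) :
    List Bool → List Bool :=
  catT (2 ^ (atomList ψ).length) (pieceFn (atomList ψ) ψ)

/-- The number of clauses of the truth-table CNF of the matrix, in unary. [folklore] -/
noncomputable def matrixCntFn {l : ℕ} (ψ : ((relLanguage ar).sum (relLanguage wit)).BoundedFormula Empty l) :
    List Bool → List Bool :=
  catT (2 ^ (atomList ψ).length) (cntPieceFn (atomList ψ) ψ)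

/-- `matrixBodyFn ψ ∈ FP`. [folklore] -/
theorem matrixBodyFn_mem_FP {l : ℕ} (ψ : ((relLanguage ar).sum (relLanguage wit)).BoundedFormula Empty l) :
    matrixBodyFn ψ ∈ FP :=
  catT_mem_FP _ fun t => pieceFn_mem_FP _ ψ t

/-- `matrixCntFn ψ ∈ FP`. [folklore] -/
theorem matrixCntFn_mem_FP {l : ℕ} (ψ : ((relLanguage ar).sum (relLanguage wit)).BoundedFormula Empty l) :
    matrixCntFn ψ ∈ FP :=
  catT_mem_FP _ fun t => cntPieceFn_mem_FP _ ψ t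

/-! ### Size polynomials -/

/-- The polynomial `Σᵢ X^{bᵢ}` of the witness table bits. [folklore] -/
noncomputable def tbPoly (wit : List ℕ) : Polynomial ℕ := ∑ i : Fin wit.length, (X : Polynomial ℕ) ^ wit.get i

/-- `tbPoly wit` evaluates to `tableBits wit`. [folklore] -/
theorem eval_tbPoly (wit : List ℕ) (m : ℕ) : (tbPoly wit).eval m = tableBits wit m := eval_tableBitsPoly wit m

/-- The size constant of the matrix: `2^A (20 A + 8)`. [folklore] -/
def sizeK (A : ℕ) : ℕ := 2 ^ A * (20 * A + 8)

/-- The size polynomial of the truth-table CNF of the matrix: `2^A (20A + 8) (Σᵢ X^{bᵢ} + 1)`. [folklore] -/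
noncomputable def matrixPoly (wit : List ℕ) (A : ℕ) : Polynomial ℕ := Polynomial.C (sizeK A) * (tbPoly wit + 1)

/-- **The size polynomial of the CNF of a formula** (one factor `X ≥ n` per universal quantifier).
[folklore] -/
noncomputable def sizePoly : ∀ {l : ℕ}, ((relLanguage ar).sum (relLanguage wit)).BoundedFormula Empty l → Polynomial ℕ
  | _, FirstOrder.Language.BoundedFormula.all f => X * sizePoly f
  | l, FirstOrder.Language.BoundedFormula.falsum =>
      matrixPoly wit (atomList (FirstOrder.Language.BoundedFormula.falsum :
        ((relLanguage ar).sum (relLanguage wit)).BoundedFormula Empty l)).length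
  | l, FirstOrder.Language.BoundedFormula.equal t₁ t₂ =>
      matrixPoly wit (atomList (FirstOrder.Language.BoundedFormula.equal t₁ t₂ :
        ((relLanguage ar).sum (relLanguage wit)).BoundedFormula Empty l)).length
  | l, FirstOrder.Language.BoundedFormula.rel Rs ts =>
      matrixPoly wit (atomList (FirstOrder.Language.BoundedFormula.rel Rs ts :
        ((relLanguage ar).sum (relLanguage wit)).BoundedFormula Empty l)).length
  | _, FirstOrder.Language.BoundedFormula.imp f₁ f₂ => matrixPoly wit (atomList (f₁.imp f₂)).length

/-! ### The recursion over the universal prefix -/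

/-- **THE LIST CODE OF THE CNF OF A UNIVERSAL FORMULA**: a universal quantifier becomes the
concatenation loop over the `n` values of its variable (`catFn`, pieces clipped to the size polynomial),
the quantifier-free matrix its truth-table CNF. [cite: ImpagliazzoPaturiZaneJCSS2001, §3, proof of Thm. 3
("for each `z̄ ∈ {1,…,n}^r` … write each such formula in conjunctive normal form")] -/
noncomputable def bodyFn : ∀ {l : ℕ}, ((relLanguage ar).sum (relLanguage wit)).BoundedFormula Empty l → (List Bool → List Bool)
  | l, FirstOrder.Language.BoundedFormula.all f => catFn l (pclipF (sizePoly f) (bodyFn f))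
  | l, FirstOrder.Language.BoundedFormula.falsum =>
      matrixBodyFn (FirstOrder.Language.BoundedFormula.falsum : ((relLanguage ar).sum (relLanguage wit)).BoundedFormula Empty l)
  | l, FirstOrder.Language.BoundedFormula.equal t₁ t₂ =>
      matrixBodyFn (FirstOrder.Language.BoundedFormula.equal t₁ t₂ : ((relLanguage ar).sum (relLanguage wit)).BoundedFormula Empty l)
  | l, FirstOrder.Language.BoundedFormula.rel Rs ts =>
      matrixBodyFn (FirstOrder.Language.BoundedFormula.rel Rs ts : ((relLanguage ar).sum (relLanguage wit)).BoundedFormula Empty l)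
  | _, FirstOrder.Language.BoundedFormula.imp f₁ f₂ => matrixBodyFn (f₁.imp f₂)

/-- The number of clauses of that CNF, in unary (same recursion, tally pieces). [folklore] -/
noncomputable def cntFn : ∀ {l : ℕ}, ((relLanguage ar).sum (relLanguage wit)).BoundedFormula Empty l → (List Bool → List Bool)
  | l, FirstOrder.Language.BoundedFormula.all f => catFn l (pclipF (sizePoly f) (cntFn f))
  | l, FirstOrder.Language.BoundedFormula.falsum =>
      matrixCntFn (FirstOrder.Language.BoundedFormula.falsum : ((relLanguage ar).sum (relLanguage wit)).BoundedFormula Empty l)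
  | l, FirstOrder.Language.BoundedFormula.equal t₁ t₂ =>
      matrixCntFn (FirstOrder.Language.BoundedFormula.equal t₁ t₂ : ((relLanguage ar).sum (relLanguage wit)).BoundedFormula Empty l)
  | l, FirstOrder.Language.BoundedFormula.rel Rs ts =>
      matrixCntFn (FirstOrder.Language.BoundedFormula.rel Rs ts : ((relLanguage ar).sum (relLanguage wit)).BoundedFormula Empty l)
  | _, FirstOrder.Language.BoundedFormula.imp f₁ f₂ => matrixCntFn (f₁.imp f₂)

/-- `bodyFn φ ∈ FP`. [cite: AroraBarak2009, §1.3] -/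
theorem bodyFn_mem_FP : ∀ {l : ℕ} (φ : ((relLanguage ar).sum (relLanguage wit)).BoundedFormula Empty l), bodyFn φ ∈ FP
  | _, FirstOrder.Language.BoundedFormula.all f => by
    rw [bodyFn]; exact catFn_pclipF_mem_FP _ _ (bodyFn_mem_FP f)
  | _, FirstOrder.Language.BoundedFormula.falsum => by rw [bodyFn]; exact matrixBodyFn_mem_FP _
  | _, FirstOrder.Language.BoundedFormula.equal _ _ => by rw [bodyFn]; exact matrixBodyFn_mem_FP _
  | _, FirstOrder.Language.BoundedFormula.rel _ _ => by rw [bodyFn]; exact matrixBodyFn_mem_FP _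
  | _, FirstOrder.Language.BoundedFormula.imp _ _ => by rw [bodyFn]; exact matrixBodyFn_mem_FP _

/-- `cntFn φ ∈ FP`. [cite: AroraBarak2009, §1.3] -/
theorem cntFn_mem_FP : ∀ {l : ℕ} (φ : ((relLanguage ar).sum (relLanguage wit)).BoundedFormula Empty l), cntFn φ ∈ FP
  | _, FirstOrder.Language.BoundedFormula.all f => by
    rw [cntFn]; exact catFn_pclipF_mem_FP _ _ (cntFn_mem_FP f)
  | _, FirstOrder.Language.BoundedFormula.falsum => by rw [cntFn]; exact matrixCntFn_mem_FP _
  | _, FirstOrder.Language.BoundedFormula.equal _ _ => by rw [cntFn]; exact matrixCntFn_mem_FP _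
  | _, FirstOrder.Language.BoundedFormula.rel _ _ => by rw [cntFn]; exact matrixCntFn_mem_FP _
  | _, FirstOrder.Language.BoundedFormula.imp _ _ => by rw [cntFn]; exact matrixCntFn_mem_FP _

/-- On a quantifier-free formula `bodyFn` is the matrix code. [folklore] -/
theorem bodyFn_of_isQF {l : ℕ} {ψ : ((relLanguage ar).sum (relLanguage wit)).BoundedFormula Empty l} (h : ψ.IsQF) :
    bodyFn ψ = matrixBodyFn ψ := by
  rcases h with _ | ⟨_, _⟩ | ⟨_, _⟩ | _ <;> rfl

/-- On a quantifier-free formula `cntFn` is the matrix count. [folklore] -/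
theorem cntFn_of_isQF {l : ℕ} {ψ : ((relLanguage ar).sum (relLanguage wit)).BoundedFormula Empty l} (h : ψ.IsQF) :
    cntFn ψ = matrixCntFn ψ := by
  rcases h with _ | ⟨_, _⟩ | ⟨_, _⟩ | _ <;> rfl

/-- On a quantifier-free formula the size polynomial is the matrix polynomial. [folklore] -/
theorem sizePoly_of_isQF {l : ℕ} {ψ : ((relLanguage ar).sum (relLanguage wit)).BoundedFormula Empty l} (h : ψ.IsQF) :
    sizePoly ψ = matrixPoly wit (atomList ψ).length := by
  rcases h with _ | ⟨_, _⟩ | ⟨_, _⟩ | _ <;> rfl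

/-! ### Well-formed keys and the range of the variables -/

/-- A key is WELL FORMED at level `l`: as many arguments as the arity, all below `l`. [folklore] -/
def KeyWF (l : ℕ) (κ : Key wit) : Prop := κ.2.length = wit.get κ.1 ∧ ∀ i ∈ κ.2, i < l

/-- The witness atoms of a formula at level `l` are well formed at level `l`. [folklore] -/
theorem keyWF_of_mem_watoms : ∀ {l : ℕ} (φ : ((relLanguage ar).sum (relLanguage wit)).BoundedFormula Empty l)
    (κ : Key wit), κ ∈ watoms φ → KeyWF l κ
  | _, FirstOrder.Language.BoundedFormula.falsum, κ, h => by simp [watoms] at h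
  | _, FirstOrder.Language.BoundedFormula.equal _ _, κ, h => by simp [watoms] at h
  | _, FirstOrder.Language.BoundedFormula.rel (Sum.inl _) _, κ, h => by simp [watoms] at h
  | _, FirstOrder.Language.BoundedFormula.rel (Sum.inr r) ts, κ, h => by
    rw [watoms, List.mem_singleton] at h
    subst h
    refine ⟨by simp [witArgs], fun i hi => ?_⟩
    obtain ⟨j, rfl⟩ := List.mem_ofFn.1 hi
    exact termVar_lt _
  | _, FirstOrder.Language.BoundedFormula.imp f₁ f₂, κ, h => by
    rw [watoms, List.mem_append] at h
    rcases h with h | h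
    · exact keyWF_of_mem_watoms f₁ κ h
    · exact keyWF_of_mem_watoms f₂ κ h
  | _, FirstOrder.Language.BoundedFormula.all _, κ, h => by simp [watoms] at h

/-- The atoms of the atom list are well formed. [folklore] -/
theorem keyWF_of_mem_atomList {l : ℕ} (φ : ((relLanguage ar).sum (relLanguage wit)).BoundedFormula Empty l)
    {κ : Key wit} (h : κ ∈ atomList φ) : KeyWF l κ :=
  keyWF_of_mem_watoms φ κ ((mem_atomList_iff φ κ).1 h)

section Range

variable {n : ℕ}

/-- The tuple of values of the arguments of a well-formed key under an assignment. [folklore] -/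
def keyTuple (vs : List ℕ) {l : ℕ} (hl : vs.length = l) (hvs : ∀ x ∈ vs, x < n) (κ : Key wit) (hκ : KeyWF l κ) :
    Fin (wit.get κ.1) → Fin n :=
  fun j => ⟨vs[κ.2[j.1]'(by rw [hκ.1]; exact j.2)]'(by rw [hl]; exact hκ.2 _ (List.getElem_mem _)),
    hvs _ (List.getElem_mem _)⟩

/-- **The variable of a key is the position of its bit**: `keyIdx = finSigmaFinEquiv ⟨i, finFunctionFinEquiv ȳ⟩`.
[folklore] -/
theorem keyIdx_eq (vs : List ℕ) {l : ℕ} (hl : vs.length = l) (hvs : ∀ x ∈ vs, x < n) (κ : Key wit) (hκ : KeyWF l κ) :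
    keyIdx n vs κ = ((finSigmaFinEquiv ⟨κ.1, finFunctionFinEquiv (keyTuple vs hl hvs κ hκ)⟩ : Fin (tableBits wit n)) : ℕ) := by
  rw [val_finSigmaFinEquiv_table, finFunctionFinEquiv_apply, keyIdx]
  congr 1
  conv_lhs => rw [show κ.2 = List.ofFn (fun j : Fin (wit.get κ.1) => κ.2[j.1]'(by rw [hκ.1]; exact j.2)) from
    (by apply List.ext_getElem <;> simp [hκ.1])]
  rw [hval_ofFn]
  refine Finset.sum_congr rfl fun j _ => ?_
  rw [List.getD_eq_getElem _ _ (by rw [hl]; exact hκ.2 _ (List.getElem_mem _))]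
  rfl

/-- Hence the variable of a key is below the number of witness bits. [cite: ImpagliazzoPaturiZaneJCSS2001, §3, proof of Thm. 3 ("exactly `Σᵢ n^{αᵢ}` variables")] -/
theorem keyIdx_lt (vs : List ℕ) {l : ℕ} (hl : vs.length = l) (hvs : ∀ x ∈ vs, x < n) (κ : Key wit) (hκ : KeyWF l κ) :
    keyIdx n vs κ < tableBits wit n := by
  rw [keyIdx_eq vs hl hvs κ hκ]; exact Fin.is_lt _

end Range

/-! ### The CNF of a formula (list level) -/

section Clauses

variable {n : ℕ} (R : RelTables ar n)

/-- **The truth-table CNF of the matrix** at the assignment `vs`: for every mask `t < 2^A` under which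
the matrix is false, the clause excluding `t`. [cite: ImpagliazzoPaturiZaneJCSS2001, §3, proof of Thm. 3] -/
def matrixClauses {l : ℕ} (ψ : ((relLanguage ar).sum (relLanguage wit)).BoundedFormula Empty l) (vs : List ℕ) : CNF ℕ :=
  (List.range (2 ^ (atomList ψ).length)).flatMap fun t =>
    if evalB R (atomList ψ) t vs ψ then [] else [clauseOf (atomList ψ) n vs t]

/-- **THE CNF OF A UNIVERSAL FORMULA** at an assignment of its free variables: the union over the values
of the universally quantified variables of the truth-table CNFs of the matrix ("for each
`z̄ ∈ {1,…,n}^r` … an equivalent `k`-CNF"). [cite: ImpagliazzoPaturiZaneJCSS2001, §3, proof of Thm. 3] -/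
def clausesB : ∀ {l : ℕ}, ((relLanguage ar).sum (relLanguage wit)).BoundedFormula Empty l → List ℕ → CNF ℕ
  | _, FirstOrder.Language.BoundedFormula.all f => fun vs => (List.range n).flatMap fun a => clausesB f (vs ++ [a])
  | l, FirstOrder.Language.BoundedFormula.falsum =>
      matrixClauses R (FirstOrder.Language.BoundedFormula.falsum : ((relLanguage ar).sum (relLanguage wit)).BoundedFormula Empty l)
  | l, FirstOrder.Language.BoundedFormula.equal t₁ t₂ =>
      matrixClauses R (FirstOrder.Language.BoundedFormula.equal t₁ t₂ : ((relLanguage ar).sum (relLanguage wit)).BoundedFormula Empty l)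
  | l, FirstOrder.Language.BoundedFormula.rel Rs ts =>
      matrixClauses R (FirstOrder.Language.BoundedFormula.rel Rs ts : ((relLanguage ar).sum (relLanguage wit)).BoundedFormula Empty l)
  | _, FirstOrder.Language.BoundedFormula.imp f₁ f₂ => matrixClauses R (f₁.imp f₂)

/-- On a quantifier-free formula the CNF is the truth-table CNF. [folklore] -/
theorem clausesB_of_isQF {l : ℕ} {ψ : ((relLanguage ar).sum (relLanguage wit)).BoundedFormula Empty l} (h : ψ.IsQF) :
    clausesB R ψ = matrixClauses R ψ := by
  rcases h with _ | ⟨_, _⟩ | ⟨_, _⟩ | _ <;> rfl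

/-- The CNF of `∀ f`. [folklore] -/
theorem clausesB_all {l : ℕ} (f : ((relLanguage ar).sum (relLanguage wit)).BoundedFormula Empty (l + 1)) (vs : List ℕ) :
    clausesB R f.all vs = (List.range n).flatMap fun a => clausesB R f (vs ++ [a]) := rfl

variable {R}

/-- Every clause of the truth-table CNF is a `clauseOf`. [folklore] -/
theorem mem_matrixClauses_iff {l : ℕ} (ψ : ((relLanguage ar).sum (relLanguage wit)).BoundedFormula Empty l)
    (vs : List ℕ) (c : Clause ℕ) :
    c ∈ matrixClauses R ψ vs ↔ ∃ t < 2 ^ (atomList ψ).length, evalB R (atomList ψ) t vs ψ = false ∧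
      c = clauseOf (atomList ψ) n vs t := by
  simp only [matrixClauses, List.mem_flatMap, List.mem_range]
  constructor
  · rintro ⟨t, ht, hc⟩
    by_cases he : evalB R (atomList ψ) t vs ψ
    · simp [he] at hc
    · simp only [he] at hc
      exact ⟨t, ht, by simpa using he, by simpa using hc⟩
  · rintro ⟨t, ht, he, rfl⟩
    exact ⟨t, ht, by simp [he]⟩

/-- The WIDTH of the CNF of a formula: the number of distinct witness atoms of its matrix.
[cite: ImpagliazzoPaturiZaneJCSS2001, §3, proof of Thm. 3 ("let `k` be the number of occurrences of the relation symbols")] -/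
def widthOf : ∀ {l : ℕ}, ((relLanguage ar).sum (relLanguage wit)).BoundedFormula Empty l → ℕ
  | _, FirstOrder.Language.BoundedFormula.all f => widthOf f
  | l, FirstOrder.Language.BoundedFormula.falsum =>
      (atomList (FirstOrder.Language.BoundedFormula.falsum : ((relLanguage ar).sum (relLanguage wit)).BoundedFormula Empty l)).length
  | l, FirstOrder.Language.BoundedFormula.equal t₁ t₂ =>
      (atomList (FirstOrder.Language.BoundedFormula.equal t₁ t₂ : ((relLanguage ar).sum (relLanguage wit)).BoundedFormula Empty l)).length
  | l, FirstOrder.Language.BoundedFormula.rel Rs ts =>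
      (atomList (FirstOrder.Language.BoundedFormula.rel Rs ts : ((relLanguage ar).sum (relLanguage wit)).BoundedFormula Empty l)).length
  | _, FirstOrder.Language.BoundedFormula.imp f₁ f₂ => (atomList (f₁.imp f₂)).length

/-- On a quantifier-free formula the width is the number of distinct witness atoms. [folklore] -/
theorem widthOf_of_isQF {l : ℕ} {ψ : ((relLanguage ar).sum (relLanguage wit)).BoundedFormula Empty l} (h : ψ.IsQF) :
    widthOf ψ = (atomList ψ).length := by
  rcases h with _ | ⟨_, _⟩ | ⟨_, _⟩ | _ <;> rfl

/-- Every clause of the truth-table CNF has exactly `A` literals. [folklore] -/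
theorem length_of_mem_matrixClauses {l : ℕ} (ψ : ((relLanguage ar).sum (relLanguage wit)).BoundedFormula Empty l)
    (vs : List ℕ) {c : Clause ℕ} (hc : c ∈ matrixClauses R ψ vs) : c.length = (atomList ψ).length := by
  obtain ⟨t, _, _, rfl⟩ := (mem_matrixClauses_iff ψ vs c).1 hc
  rw [clauseOf, length_litsOf]

/-- **Every clause of the CNF of a formula has exactly `widthOf` literals.** [cite: ImpagliazzoPaturiZaneJCSS2001, §3, proof of Thm. 3] -/
theorem length_of_mem_clausesB : ∀ {l : ℕ} (φ : ((relLanguage ar).sum (relLanguage wit)).BoundedFormula Empty l)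
    (vs : List ℕ) {c : Clause ℕ}, c ∈ clausesB R φ vs → c.length = widthOf φ
  | _, FirstOrder.Language.BoundedFormula.all f, vs, c, hc => by
    rw [clausesB_all, List.mem_flatMap] at hc
    obtain ⟨a, _, hc⟩ := hc
    rw [widthOf]; exact length_of_mem_clausesB f _ hc
  | _, FirstOrder.Language.BoundedFormula.falsum, vs, c, hc => length_of_mem_matrixClauses _ vs hc
  | _, FirstOrder.Language.BoundedFormula.equal _ _, vs, c, hc => length_of_mem_matrixClauses _ vs hc
  | _, FirstOrder.Language.BoundedFormula.rel _ _, vs, c, hc => length_of_mem_matrixClauses _ vs hc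
  | _, FirstOrder.Language.BoundedFormula.imp _ _, vs, c, hc => length_of_mem_matrixClauses _ vs hc

/-- Every variable of the truth-table CNF is a bit position `< witnessBits`. [folklore] -/
theorem lt_of_mem_matrixClauses {l : ℕ} (ψ : ((relLanguage ar).sum (relLanguage wit)).BoundedFormula Empty l)
    (vs : List ℕ) (hl : vs.length = l) (hvs : ∀ x ∈ vs, x < n) {c : Clause ℕ} (hc : c ∈ matrixClauses R ψ vs)
    {lit : Literal ℕ} (hlit : lit ∈ c) : lit.1 < tableBits wit n := by
  obtain ⟨t, _, _, rfl⟩ := (mem_matrixClauses_iff ψ vs c).1 hc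
  rw [clauseOf, mem_litsOf_iff] at hlit
  obtain ⟨i, hi, rfl⟩ := hlit
  exact keyIdx_lt vs hl hvs _ (keyWF_of_mem_atomList ψ (List.getElem_mem hi))

/-- **Every variable of the CNF of a formula is a bit position `< witnessBits n`** ("exactly
`Σᵢ n^{αᵢ}` variables"). [cite: ImpagliazzoPaturiZaneJCSS2001, §3, proof of Thm. 3] -/
theorem lt_of_mem_clausesB : ∀ {l : ℕ} (φ : ((relLanguage ar).sum (relLanguage wit)).BoundedFormula Empty l)
    (vs : List ℕ) (_hl : vs.length = l) (_hvs : ∀ x ∈ vs, x < n) {c : Clause ℕ}, c ∈ clausesB R φ vs →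
    ∀ {lit : Literal ℕ}, lit ∈ c → lit.1 < tableBits wit n
  | _, FirstOrder.Language.BoundedFormula.all f, vs, hl, hvs, c, hc => by
    rw [clausesB_all, List.mem_flatMap] at hc
    obtain ⟨a, ha, hc⟩ := hc
    rw [List.mem_range] at ha
    refine lt_of_mem_clausesB f (vs ++ [a]) (by simp [hl]) (fun x hx => ?_) hc
    rcases List.mem_append.1 hx with hx | hx
    · exact hvs x hx
    · rw [List.mem_singleton.1 hx]; exact ha
  | _, FirstOrder.Language.BoundedFormula.falsum, vs, hl, hvs, c, hc => lt_of_mem_matrixClauses _ vs hl hvs hc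
  | _, FirstOrder.Language.BoundedFormula.equal _ _, vs, hl, hvs, c, hc => lt_of_mem_matrixClauses _ vs hl hvs hc
  | _, FirstOrder.Language.BoundedFormula.rel _ _, vs, hl, hvs, c, hc => lt_of_mem_matrixClauses _ vs hl hvs hc
  | _, FirstOrder.Language.BoundedFormula.imp _ _, vs, hl, hvs, c, hc => lt_of_mem_matrixClauses _ vs hl hvs hc

end Clauses

/-! ### Sizes of the codes -/

section Sizes

variable {n : ℕ} {R : RelTables ar n}

/-- The length of the code of a literal. [folklore] -/
theorem length_encode_lit_le (v : ℕ) (b : Bool) : (encodingLiteral.encode (v, b)).length ≤ 2 * v + 5 := by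
  rw [SerfRename.encode_lit_eq, length_boolPair]
  have := TM2Pass.length_encodeNat_le_self v
  simp only [List.length_singleton]
  omega

/-- The length of a list code with bounded items (twin of `DinurSafraFP.length_encList_le_of_bound`,
`Complexity/CSPToCMMSAReductionProofs.lean`, which sits on top of the Dinur–Safra reduction and is not imported
into this file). [folklore] -/
theorem length_encList_le_of_forall {L : List (List Bool)} {B : ℕ} (h : ∀ a ∈ L, a.length ≤ B) :
    (encList L).length ≤ L.length * (2 * B + 2) := by
  induction L with
  | nil => simp
  | cons a L ih =>
    rw [encList_cons, length_boolPair, List.length_cons]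
    have h1 := h a (by simp)
    have h2 := ih fun b hb => h b (by simp [hb])
    nlinarith

/-- List codes of concatenations. [folklore] -/
theorem encList_flatMap_map {α : Type} (L : List α) (g : α → List (List Bool)) :
    encList (L.flatMap g) = (L.map fun a => encList (g a)).flatten := by
  induction L with
  | nil => rfl
  | cons a L ih => rw [List.flatMap_cons, Ladder3.encList_append, ih, List.map_cons, List.flatten_cons]

/-- The length of the code of a clause excluding a mask: `≤ A (4 · witnessBits + 10) + 2`. [folklore] -/
theorem length_encode_clauseOf_le (atoms : List (Key wit)) {l : ℕ} (hwf : ∀ κ ∈ atoms, KeyWF l κ)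
    (vs : List ℕ) (hl : vs.length = l) (hvs : ∀ x ∈ vs, x < n) (t : ℕ) :
    (encodingClause.encode (clauseOf atoms n vs t)).length ≤ atoms.length * (4 * tableBits wit n + 10) + 2 := by
  change (encodingLiteral.listBool.encode (clauseOf atoms n vs t)).length ≤ _
  rw [listBool_encode_eq_encList, length_boolPair, OracleCompose.unaryEncodeNat_eq_replicate, List.length_replicate,
    clauseOf, length_litsOf]
  have hB : ∀ a ∈ (litsOf n vs t atoms 0).map encodingLiteral.encode, a.length ≤ 2 * tableBits wit n + 3 := by
    intro a ha
    obtain ⟨lit, hlit, rfl⟩ := List.mem_map.1 ha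
    obtain ⟨i, hi, rfl⟩ := (mem_litsOf_iff n vs t atoms 0 lit).1 hlit
    have hlt := keyIdx_lt vs hl hvs _ (hwf _ (List.getElem_mem hi))
    have := length_encode_lit_le (keyIdx n vs atoms[i]) (!t.testBit (0 + i))
    omega
  have h := length_encList_le_of_forall hB
  rw [List.length_map, length_litsOf] at h
  nlinarith

/-- The truth-table CNF has at most `2^A` clauses. [folklore] -/
theorem length_matrixClauses_le {l : ℕ} (ψ : ((relLanguage ar).sum (relLanguage wit)).BoundedFormula Empty l) (vs : List ℕ) :
    (matrixClauses R ψ vs).length ≤ 2 ^ (atomList ψ).length := by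
  unfold matrixClauses
  rw [List.length_flatMap]
  refine (List.sum_le_card_nsmul _ 1 fun x hx => ?_).trans (by simp)
  obtain ⟨t, _, rfl⟩ := List.mem_map.1 hx
  split_ifs <;> simp

/-- **The size of the list code of the truth-table CNF**: `≤ 2^A (20A + 8)(witnessBits + 1)`. [folklore] -/
theorem length_encList_matrixClauses_le {l : ℕ} (ψ : ((relLanguage ar).sum (relLanguage wit)).BoundedFormula Empty l)
    (vs : List ℕ) (hl : vs.length = l) (hvs : ∀ x ∈ vs, x < n) :
    (encList ((matrixClauses R ψ vs).map encodingClause.encode)).length ≤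
      sizeK (atomList ψ).length * (tableBits wit n + 1) := by
  set A := (atomList ψ).length with hA
  set TB := tableBits wit n with hTB
  have hB : ∀ a ∈ (matrixClauses R ψ vs).map encodingClause.encode, a.length ≤ A * (4 * TB + 10) + 2 := by
    intro a ha
    obtain ⟨c, hc, rfl⟩ := List.mem_map.1 ha
    obtain ⟨t, _, _, rfl⟩ := (mem_matrixClauses_iff ψ vs c).1 hc
    exact length_encode_clauseOf_le _ (fun κ hκ => keyWF_of_mem_atomList ψ hκ) vs hl hvs t
  have h1 := length_encList_le_of_forall hB
  have h2 : ((matrixClauses R ψ vs).map encodingClause.encode).length ≤ 2 ^ A := by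
    rw [List.length_map]; exact length_matrixClauses_le ψ vs
  have h3 : 2 * (A * (4 * TB + 10) + 2) + 2 ≤ (20 * A + 8) * (TB + 1) := by nlinarith
  calc (encList ((matrixClauses R ψ vs).map encodingClause.encode)).length
      ≤ ((matrixClauses R ψ vs).map encodingClause.encode).length * (2 * (A * (4 * TB + 10) + 2) + 2) := h1
    _ ≤ 2 ^ A * ((20 * A + 8) * (TB + 1)) := Nat.mul_le_mul h2 h3
    _ = sizeK A * (TB + 1) := by rw [sizeK]; ring

/-- Evaluation of the matrix size polynomial. [folklore] -/
theorem eval_matrixPoly (wit : List ℕ) (A m : ℕ) : (matrixPoly wit A).eval m = sizeK A * (tableBits wit m + 1) := by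
  simp [matrixPoly, eval_tbPoly]

/-- **The size of the list code of the CNF of a formula is within the size polynomial** (at any
`m ≥ n`). [folklore] -/
theorem length_encList_clausesB_le {m : ℕ} (hm : n ≤ m) :
    ∀ {l : ℕ} (φ : ((relLanguage ar).sum (relLanguage wit)).BoundedFormula Empty l)
      (vs : List ℕ) (_hl : vs.length = l) (_hvs : ∀ x ∈ vs, x < n),
      (encList ((clausesB R φ vs).map encodingClause.encode)).length ≤ (sizePoly φ).eval m := by
  have hmat : ∀ {l : ℕ} (ψ : ((relLanguage ar).sum (relLanguage wit)).BoundedFormula Empty l)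
      (vs : List ℕ) (hl : vs.length = l) (hvs : ∀ x ∈ vs, x < n),
      (encList ((matrixClauses R ψ vs).map encodingClause.encode)).length ≤ (matrixPoly wit (atomList ψ).length).eval m := by
    intro l ψ vs hl hvs
    rw [eval_matrixPoly]
    exact (length_encList_matrixClauses_le ψ vs hl hvs).trans
      (Nat.mul_le_mul_left _ (Nat.succ_le_succ (tableBits_mono wit hm)))
  intro l φ
  induction φ with
  | falsum => intro vs hl hvs; exact hmat _ vs hl hvs
  | equal t₁ t₂ => intro vs hl hvs; exact hmat _ vs hl hvs
  | rel Rs ts => intro vs hl hvs; exact hmat _ vs hl hvs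
  | imp f₁ f₂ _ _ => intro vs hl hvs; exact hmat _ vs hl hvs
  | all f ih =>
    intro vs hl hvs
    rw [clausesB_all, List.map_flatMap, encList_flatMap_map, List.length_flatten, List.map_map, sizePoly, eval_mul, eval_X]
    have hb : ∀ x ∈ (List.range n).map (List.length ∘ fun a => encList ((clausesB R f (vs ++ [a])).map encodingClause.encode)),
        x ≤ (sizePoly f).eval m := by
      intro x hx
      obtain ⟨a, ha, rfl⟩ := List.mem_map.1 hx
      rw [List.mem_range] at ha
      refine ih (vs ++ [a]) (by simp [hl]) fun y hy => ?_
      rcases List.mem_append.1 hy with hy | hy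
      · exact hvs y hy
      · rw [List.mem_singleton.1 hy]; exact ha
    refine (List.sum_le_card_nsmul _ _ hb).trans ?_
    simp only [List.length_map, List.length_range, smul_eq_mul]
    exact Nat.mul_le_mul_right _ hm

/-- **The number of clauses is within the size polynomial.** [folklore] -/
theorem length_clausesB_le {m : ℕ} (hm : n ≤ m) :
    ∀ {l : ℕ} (φ : ((relLanguage ar).sum (relLanguage wit)).BoundedFormula Empty l) (vs : List ℕ),
      (clausesB R φ vs).length ≤ (sizePoly φ).eval m := by
  have hmat : ∀ {l : ℕ} (ψ : ((relLanguage ar).sum (relLanguage wit)).BoundedFormula Empty l) (vs : List ℕ),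
      (matrixClauses R ψ vs).length ≤ (matrixPoly wit (atomList ψ).length).eval m := by
    intro l ψ vs
    rw [eval_matrixPoly, sizeK]
    refine (length_matrixClauses_le ψ vs).trans ?_
    have h1 : 1 ≤ 20 * (atomList ψ).length + 8 := by omega
    have h2 : 1 ≤ tableBits wit m + 1 := by omega
    calc 2 ^ (atomList ψ).length = 2 ^ (atomList ψ).length * 1 * 1 := by ring
      _ ≤ 2 ^ (atomList ψ).length * (20 * (atomList ψ).length + 8) * (tableBits wit m + 1) := by gcongr
  intro l φ
  induction φ with
  | falsum => intro vs; exact hmat _ vs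
  | equal t₁ t₂ => intro vs; exact hmat _ vs
  | rel Rs ts => intro vs; exact hmat _ vs
  | imp f₁ f₂ _ _ => intro vs; exact hmat _ vs
  | all f ih =>
    intro vs
    rw [clausesB_all, List.length_flatMap, sizePoly, eval_mul, eval_X]
    have hb : ∀ x ∈ (List.range n).map (List.length ∘ fun a => clausesB R f (vs ++ [a])), x ≤ (sizePoly f).eval m := by
      intro x hx
      obtain ⟨a, _, rfl⟩ := List.mem_map.1 hx
      exact ih (vs ++ [a])
    refine (List.sum_le_card_nsmul _ _ hb).trans ?_
    simp only [List.length_map, List.length_range, smul_eq_mul]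
    exact Nat.mul_le_mul_right _ hm

end Sizes

/-! ### Values of the string functions on genuine argument words -/

section Values

variable {n : ℕ} {R : RelTables ar n}

/-- The code of a literal. [folklore] -/
theorem litFn_arg (hz : n ≤ (zOf R).length) (vs : List ℕ) (hvs : ∀ x ∈ vs, x < n) (κ : Key wit)
    (hargs : ∀ i ∈ κ.2, i < vs.length) (b : Bool) :
    litFn κ b (boolPair (zOf R) (codeL vs)) = encodingLiteral.encode (keyIdx n vs κ, b) := by
  obtain ⟨_, _, hnz⟩ := decode_zOf R
  have hz' : nOf (zOf R) ≤ (zOf R).length := by rw [hnz]; exact hz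
  have hvs' : ∀ x ∈ vs, x < nOf (zOf R) := by rw [hnz]; exact hvs
  rw [SerfRename.encode_lit_eq, litFn, fanoutFn_apply, Function.comp_apply, lenBinF_apply,
    length_atomIdxFn wit κ.1 (zOf R) hz' vs hvs' κ.2 hargs, hnz]
  rfl

/-- The list code of the literals. [folklore] -/
theorem litsFn_arg (hz : n ≤ (zOf R).length) (vs : List ℕ) (hvs : ∀ x ∈ vs, x < n) (t : ℕ) :
    ∀ (keys : List (Key wit)) (_hargs : ∀ κ ∈ keys, ∀ i ∈ κ.2, i < vs.length) (j : ℕ),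
      litsFn t keys j (boolPair (zOf R) (codeL vs)) = encList ((litsOf n vs t keys j).map encodingLiteral.encode)
  | [], _, _ => rfl
  | κ :: rest, hargs, j => by
    rw [litsFn, fanoutFn_apply, litFn_arg hz vs hvs κ (hargs κ (by simp)) _,
      litsFn_arg hz vs hvs t rest (fun κ' h => hargs κ' (by simp [h])) (j + 1), litsOf, List.map_cons, encList_cons]

/-- **The code of the clause excluding a mask.** [folklore] -/
theorem clauseFn_arg (hz : n ≤ (zOf R).length) (vs : List ℕ) (hvs : ∀ x ∈ vs, x < n) (atoms : List (Key wit))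
    (hargs : ∀ κ ∈ atoms, ∀ i ∈ κ.2, i < vs.length) (t : ℕ) :
    clauseFn atoms t (boolPair (zOf R) (codeL vs)) = encodingClause.encode (clauseOf atoms n vs t) := by
  change _ = encodingLiteral.listBool.encode (clauseOf atoms n vs t)
  rw [listBool_encode_eq_encList, clauseFn, fanoutFn_apply, litsFn_arg hz vs hvs t atoms hargs 0, clauseOf, length_litsOf]

/-- The body piece of a mask. [folklore] -/
theorem pieceFn_arg (hz : n ≤ (zOf R).length) {l : ℕ} (ψ : ((relLanguage ar).sum (relLanguage wit)).BoundedFormula Empty l)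
    (vs : List ℕ) (hl : vs.length = l) (hvs : ∀ x ∈ vs, x < n) (t : ℕ) :
    pieceFn (atomList ψ) ψ t (boolPair (zOf R) (codeL vs)) =
      encList ((if evalB R (atomList ψ) t vs ψ then [] else [clauseOf (atomList ψ) n vs t]).map encodingClause.encode) := by
  have hargs : ∀ κ ∈ atomList ψ, ∀ i ∈ κ.2, i < vs.length := fun κ hκ i hi => by
    rw [hl]; exact (keyWF_of_mem_atomList ψ hκ).2 i hi
  rw [pieceFn, iteFn_apply (evalWFn_spec hz (atomList ψ) t ψ vs hl hvs)]
  by_cases he : evalB R (atomList ψ) t vs ψ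
  · simp [he]
  · simp only [he, Bool.false_eq_true, ↓reduceIte, fanoutFn_apply, clauseFn_arg hz vs hvs _ hargs t, List.map_cons,
      List.map_nil, encList_cons, encList_nil]

/-- The count piece of a mask. [folklore] -/
theorem cntPieceFn_arg (hz : n ≤ (zOf R).length) {l : ℕ} (ψ : ((relLanguage ar).sum (relLanguage wit)).BoundedFormula Empty l)
    (vs : List ℕ) (hl : vs.length = l) (hvs : ∀ x ∈ vs, x < n) (t : ℕ) :
    cntPieceFn (atomList ψ) ψ t (boolPair (zOf R) (codeL vs)) =
      List.replicate (if evalB R (atomList ψ) t vs ψ then [] else [clauseOf (atomList ψ) n vs t]).length true := by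
  rw [cntPieceFn, iteFn_apply (evalWFn_spec hz (atomList ψ) t ψ vs hl hvs)]
  by_cases he : evalB R (atomList ψ) t vs ψ <;> simp [he]

/-- **The list code of the truth-table CNF.** [folklore] -/
theorem matrixBodyFn_arg (hz : n ≤ (zOf R).length) {l : ℕ} (ψ : ((relLanguage ar).sum (relLanguage wit)).BoundedFormula Empty l)
    (vs : List ℕ) (hl : vs.length = l) (hvs : ∀ x ∈ vs, x < n) :
    matrixBodyFn ψ (boolPair (zOf R) (codeL vs)) = encList ((matrixClauses R ψ vs).map encodingClause.encode) := by
  rw [matrixBodyFn, catT_apply, matrixClauses, List.map_flatMap, encList_flatMap_map]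
  congr 1
  refine List.map_congr_left fun t _ => ?_
  rw [pieceFn_arg hz ψ vs hl hvs t]

/-- Tally marks of a concatenation. [folklore] -/
theorem flatten_map_replicate {α : Type} (L : List α) (m : α → ℕ) :
    (L.map fun a => List.replicate (m a) true).flatten = List.replicate (L.map m).sum true := by
  induction L with
  | nil => rfl
  | cons a L ih => rw [List.map_cons, List.flatten_cons, ih, List.map_cons, List.sum_cons, List.replicate_add]

/-- **The number of clauses of the truth-table CNF, in unary.** [folklore] -/
theorem matrixCntFn_arg (hz : n ≤ (zOf R).length) {l : ℕ} (ψ : ((relLanguage ar).sum (relLanguage wit)).BoundedFormula Empty l)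
    (vs : List ℕ) (hl : vs.length = l) (hvs : ∀ x ∈ vs, x < n) :
    matrixCntFn ψ (boolPair (zOf R) (codeL vs)) = List.replicate (matrixClauses R ψ vs).length true := by
  rw [matrixCntFn, catT_apply, matrixClauses, List.length_flatMap]
  rw [show (List.range (2 ^ (atomList ψ).length)).map (fun t => cntPieceFn (atomList ψ) ψ t (boolPair (zOf R) (codeL vs))) =
      (List.range (2 ^ (atomList ψ).length)).map (fun t => List.replicate
        (if evalB R (atomList ψ) t vs ψ then [] else [clauseOf (atomList ψ) n vs t]).length true) from
    List.map_congr_left fun t _ => cntPieceFn_arg hz ψ vs hl hvs t, flatten_map_replicate]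

/-- The list code of the CNF of `∀ f`, as a concatenation. [folklore] -/
theorem encList_clausesB_all {l : ℕ} (f : ((relLanguage ar).sum (relLanguage wit)).BoundedFormula Empty (l + 1)) (vs : List ℕ) :
    encList ((clausesB R f.all vs).map encodingClause.encode) =
      ((List.range n).map fun a => encList ((clausesB R f (vs ++ [a])).map encodingClause.encode)).flatten := by
  rw [clausesB_all, List.map_flatMap, encList_flatMap_map]

/-- The number of clauses of the CNF of `∀ f`, as a sum. [folklore] -/
theorem length_clausesB_all {l : ℕ} (f : ((relLanguage ar).sum (relLanguage wit)).BoundedFormula Empty (l + 1)) (vs : List ℕ) :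
    (clausesB R f.all vs).length = ((List.range n).map fun a => (clausesB R f (vs ++ [a])).length).sum := by
  rw [clausesB_all, List.length_flatMap]

/-- **THE VALUE OF `bodyFn`**: on `⟨zOf R, codeL vs⟩` it is the list code of the clause codes of
`clausesB R φ vs` (the pieces of the concatenation loops are within the size polynomial, so the
clipping is inactive). [cite: ImpagliazzoPaturiZaneJCSS2001, §3, proof of Thm. 3] -/
theorem bodyFn_arg (hz : n ≤ (zOf R).length) :
    ∀ {l : ℕ} (φ : ((relLanguage ar).sum (relLanguage wit)).BoundedFormula Empty l)
      (vs : List ℕ) (_hl : vs.length = l) (_hvs : ∀ x ∈ vs, x < n),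
      bodyFn φ (boolPair (zOf R) (codeL vs)) = encList ((clausesB R φ vs).map encodingClause.encode) := by
  obtain ⟨_, _, hnz⟩ := decode_zOf R
  have hz' : nOf (zOf R) ≤ (zOf R).length := by rw [hnz]; exact hz
  intro l φ
  induction φ with
  | falsum => intro vs hl hvs; exact matrixBodyFn_arg hz _ vs hl hvs
  | equal t₁ t₂ => intro vs hl hvs; exact matrixBodyFn_arg hz _ vs hl hvs
  | rel Rs ts => intro vs hl hvs; exact matrixBodyFn_arg hz _ vs hl hvs
  | imp f₁ f₂ _ _ => intro vs hl hvs; exact matrixBodyFn_arg hz _ vs hl hvs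
  | @all l f ih =>
    intro vs hl hvs
    have hfun : ∀ a ∈ List.range n, pclipF (sizePoly f) (bodyFn f) (boolPair (zOf R) (codeL (vs ++ [0 + a]))) =
        encList ((clausesB R f (vs ++ [a])).map encodingClause.encode) := by
      intro a ha
      rw [List.mem_range] at ha
      have hvs' : ∀ x ∈ vs ++ [a], x < n := fun x hx => by
        rcases List.mem_append.1 hx with hx | hx
        · exact hvs x hx
        · rw [List.mem_singleton.1 hx]; exact ha
      have hval := ih (vs ++ [a]) (by simp [hl]) hvs'
      rw [Nat.zero_add, pclipF_eq_self, hval]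
      rw [hval, fstF_boolPair]
      exact length_encList_clausesB_le hz f (vs ++ [a]) (by simp [hl]) hvs'
    rw [bodyFn, catFn_spec l _ (zOf R) (codeL vs) hz', catPieces_codeL l _ _ vs hl, hnz, encList_clausesB_all]
    exact congrArg List.flatten (List.map_congr_left hfun)

/-- **THE VALUE OF `cntFn`**: the number of clauses of `clausesB R φ vs`, in unary. [folklore] -/
theorem cntFn_arg (hz : n ≤ (zOf R).length) :
    ∀ {l : ℕ} (φ : ((relLanguage ar).sum (relLanguage wit)).BoundedFormula Empty l)
      (vs : List ℕ) (_hl : vs.length = l) (_hvs : ∀ x ∈ vs, x < n),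
      cntFn φ (boolPair (zOf R) (codeL vs)) = List.replicate (clausesB R φ vs).length true := by
  obtain ⟨_, _, hnz⟩ := decode_zOf R
  have hz' : nOf (zOf R) ≤ (zOf R).length := by rw [hnz]; exact hz
  intro l φ
  induction φ with
  | falsum => intro vs hl hvs; exact matrixCntFn_arg hz _ vs hl hvs
  | equal t₁ t₂ => intro vs hl hvs; exact matrixCntFn_arg hz _ vs hl hvs
  | rel Rs ts => intro vs hl hvs; exact matrixCntFn_arg hz _ vs hl hvs
  | imp f₁ f₂ _ _ => intro vs hl hvs; exact matrixCntFn_arg hz _ vs hl hvs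
  | @all l f ih =>
    intro vs hl hvs
    have hfun : ∀ a ∈ List.range n, pclipF (sizePoly f) (cntFn f) (boolPair (zOf R) (codeL (vs ++ [0 + a]))) =
        List.replicate (clausesB R f (vs ++ [a])).length true := by
      intro a ha
      rw [List.mem_range] at ha
      have hvs' : ∀ x ∈ vs ++ [a], x < n := fun x hx => by
        rcases List.mem_append.1 hx with hx | hx
        · exact hvs x hx
        · rw [List.mem_singleton.1 hx]; exact ha
      have hval := ih (vs ++ [a]) (by simp [hl]) hvs'
      rw [Nat.zero_add, pclipF_eq_self, hval]
      rw [hval, fstF_boolPair, List.length_replicate]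
      exact length_clausesB_le hz f (vs ++ [a])
    rw [cntFn, catFn_spec l _ (zOf R) (codeL vs) hz', catPieces_codeL l _ _ vs hl, hnz, length_clausesB_all,
      ← flatten_map_replicate]
    exact congrArg List.flatten (List.map_congr_left hfun)

end Values

/-! ### Semantics: satisfying assignments are witness tables -/

section Semantics

open scoped Classical

variable {n : ℕ} {R : RelTables ar n}

/-- **The witness tables of an assignment**: the bit of `Sᵢ(ȳ)` is the value of the variable at the
position of that bit. [cite: ImpagliazzoPaturiZaneJCSS2001, §3, proof of Thm. 3 ("a variable `x_{i,ȳ}`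
representing whether `Rᵢ(ȳ)` is true")] -/
def tablesOfAssignment (wit : List ℕ) (n : ℕ) (σ : ℕ → Bool) : RelTables wit n :=
  fun s w => σ ((finSigmaFinEquiv ⟨s, finFunctionFinEquiv w⟩ : Fin (tableBits wit n)) : ℕ)

/-- The assignment of witness tables: position `v` carries bit `v` of the table code. [folklore] -/
def assignmentOfTables {wit : List ℕ} {n : ℕ} (W : RelTables wit n) : ℕ → Bool :=
  fun v => if h : v < tableBits wit n then relTablesEquiv wit n W ⟨v, h⟩ else false

/-- The tables of the assignment of tables `W` are `W`. [folklore] -/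
theorem tablesOfAssignment_assignmentOfTables {wit : List ℕ} {n : ℕ} (W : RelTables wit n) :
    tablesOfAssignment wit n (assignmentOfTables W) = W := by
  funext s w
  unfold tablesOfAssignment assignmentOfTables
  rw [dif_pos (show ((finSigmaFinEquiv ⟨s, finFunctionFinEquiv w⟩ : Fin (tableBits wit n)) : ℕ) < tableBits wit n from
    Fin.is_lt _)]
  exact relTablesEquiv_apply_table W s w

/-- The mask of an assignment at `vs`: bit `i` is the value of the variable of atom `i`. [folklore] -/
def maskOf (atoms : List (Key wit)) (n : ℕ) (vs : List ℕ) (σ : ℕ → Bool) : ℕ :=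
  bitsToNat (List.ofFn fun i : Fin atoms.length => σ (keyIdx n vs atoms[i.1]))

/-- The mask of an assignment is below `2^A`. [folklore] -/
theorem maskOf_lt (atoms : List (Key wit)) (n : ℕ) (vs : List ℕ) (σ : ℕ → Bool) : maskOf atoms n vs σ < 2 ^ atoms.length := by
  have h := bitsToNat_lt (List.ofFn fun i : Fin atoms.length => σ (keyIdx n vs atoms[i.1]))
  rwa [List.length_ofFn] at h

/-- The bits of the mask of an assignment. [folklore] -/
theorem testBit_maskOf (atoms : List (Key wit)) (n : ℕ) (vs : List ℕ) (σ : ℕ → Bool) {i : ℕ} (hi : i < atoms.length) :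
    (maskOf atoms n vs σ).testBit i = σ (keyIdx n vs atoms[i]) := by
  have h := getElem?_eq_testBit (List.ofFn fun i : Fin atoms.length => σ (keyIdx n vs atoms[i.1])) (i := i) (by simpa using hi)
  rw [List.getElem?_eq_getElem (by simpa using hi), List.getElem_ofFn, Option.some.injEq] at h
  rw [maskOf, ← h]

/-- A mask `t < 2^A` with the bits of the mask of `σ` is that mask. [folklore] -/
theorem eq_maskOf_of_testBit (atoms : List (Key wit)) (n : ℕ) (vs : List ℕ) (σ : ℕ → Bool) {t : ℕ}
    (ht : t < 2 ^ atoms.length) (h : ∀ (i : ℕ) (hi : i < atoms.length), t.testBit i = σ (keyIdx n vs (atoms[i]'hi))) :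
    t = maskOf atoms n vs σ := by
  refine Nat.eq_of_testBit_eq fun i => ?_
  by_cases hi : i < atoms.length
  · rw [h i hi, testBit_maskOf atoms n vs σ hi]
  · have h2 : 2 ^ atoms.length ≤ 2 ^ i := Nat.pow_le_pow_right (by norm_num) (not_lt.1 hi)
    rw [Nat.testBit_eq_false_of_lt (ht.trans_le h2), Nat.testBit_eq_false_of_lt ((maskOf_lt atoms n vs σ).trans_le h2)]

/-- **A clause excluding a mask is satisfied exactly by the assignments of a different mask.**
[cite: ImpagliazzoPaturiZaneJCSS2001, §3, proof of Thm. 3 (the CNF of a Boolean function)] -/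
theorem eval_clauseOf_eq_true_iff (atoms : List (Key wit)) (n : ℕ) (vs : List ℕ) (σ : ℕ → Bool) {t : ℕ}
    (ht : t < 2 ^ atoms.length) : Clause.eval σ (clauseOf atoms n vs t) = true ↔ t ≠ maskOf atoms n vs σ := by
  rw [Clause.eval, List.any_eq_true]
  constructor
  · rintro ⟨lit, hlit, hev⟩ rfl
    rw [clauseOf, mem_litsOf_iff] at hlit
    obtain ⟨i, hi, rfl⟩ := hlit
    rw [Literal.eval, Nat.zero_add, testBit_maskOf atoms n vs σ hi] at hev
    revert hev
    cases σ (keyIdx n vs atoms[i]) <;> simp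
  · intro hne
    by_contra hall
    push Not at hall
    apply hne (eq_maskOf_of_testBit atoms n vs σ ht fun i hi => ?_)
    have hmem : (keyIdx n vs atoms[i], !t.testBit (0 + i)) ∈ clauseOf atoms n vs t := by
      rw [clauseOf, mem_litsOf_iff]; exact ⟨i, hi, rfl⟩
    have hev := hall _ hmem
    rw [Literal.eval, Nat.zero_add] at hev
    revert hev
    cases σ (keyIdx n vs atoms[i]) <;> cases t.testBit i <;> simp

/-- The mask of an assignment gives every atom of the matrix its value under the witness tables of the
assignment. [folklore] -/
theorem maskVal_maskOf {l : ℕ} (ψ : ((relLanguage ar).sum (relLanguage wit)).BoundedFormula Empty l)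
    (vs : List ℕ) (hl : vs.length = l) (hvs : ∀ x ∈ vs, x < n) (σ : ℕ → Bool)
    (κ : Key wit) (hκ : κ ∈ watoms ψ) :
    maskVal (atomList ψ) (maskOf (atomList ψ) n vs σ) κ = keyVal (tablesOfAssignment wit n σ) vs κ := by
  have hmem : κ ∈ atomList ψ := (mem_atomList_iff ψ κ).2 hκ
  have hwf : KeyWF l κ := keyWF_of_mem_atomList ψ hmem
  have hi : (atomList ψ).idxOf κ < (atomList ψ).length := List.idxOf_lt_length_iff.2 hmem
  have hj : ∀ j : Fin (wit.get κ.1), (j : ℕ) < κ.2.length := fun j => by rw [hwf.1]; exact j.2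
  have hgetD : ∀ j : Fin (wit.get κ.1), κ.2.getD j 0 = κ.2[j.1]'(hj j) := fun j => List.getD_eq_getElem _ _ (hj j)
  have hlt' : ∀ j : Fin (wit.get κ.1), κ.2[j.1]'(hj j) < vs.length := fun j => by
    rw [hl]; exact hwf.2 _ (List.getElem_mem _)
  have hlt : ∀ j : Fin (wit.get κ.1), vs.getD (κ.2.getD j 0) 0 < n := fun j => by
    rw [hgetD j, List.getD_eq_getElem _ _ (hlt' j)]
    exact hvs _ (List.getElem_mem _)
  have htup : keyTuple vs hl hvs κ hwf = fun j => ⟨vs.getD (κ.2.getD j 0) 0, hlt j⟩ := funext fun j => Fin.ext (by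
    simp only [keyTuple]
    rw [hgetD j, List.getD_eq_getElem _ _ (hlt' j)])
  rw [maskVal, testBit_maskOf _ n vs σ hi, List.getElem_idxOf hi, keyVal, dif_pos hlt, tablesOfAssignment,
    keyIdx_eq vs hl hvs κ hwf, htup]

/-- Extending a list of values below `n`. [folklore] -/
theorem forall_lt_append_singleton {vs : List ℕ} (hvs : ∀ x ∈ vs, x < n) {a : ℕ} (ha : a < n) :
    ∀ x ∈ vs ++ [a], x < n := fun x hx => by
  rcases List.mem_append.1 hx with hx | hx
  · exact hvs x hx
  · rw [List.mem_singleton.1 hx]; exact ha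

/-- **MAIN SEMANTIC LEMMA**: an assignment satisfies all clauses of the CNF of a UNIVERSAL formula at
`vs` iff the formula holds at `vs` in `(R, W_σ)` for the witness tables `W_σ` read off the assignment.
[cite: ImpagliazzoPaturiZaneJCSS2001, §3, proof of Thm. 3] -/
theorem forall_eval_clausesB_iff {l : ℕ} {φ : ((relLanguage ar).sum (relLanguage wit)).BoundedFormula Empty l}
    (hφ : φ.IsUniversal) (σ : ℕ → Bool) :
    ∀ (vs : List ℕ) (hl : vs.length = l) (hvs : ∀ x ∈ vs, x < n),
      (∀ c ∈ clausesB R φ vs, Clause.eval σ c = true) ↔ RealizesB R (tablesOfAssignment wit n σ) φ (xsOf vs hl hvs) := by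
  induction hφ with
  | @of_isQF l ψ hq =>
    intro vs hl hvs
    rw [clausesB_of_isQF R hq]
    have key : (∀ c ∈ matrixClauses R ψ vs, Clause.eval σ c = true) ↔
        evalB R (atomList ψ) (maskOf (atomList ψ) n vs σ) vs ψ = true := by
      constructor
      · intro h
        by_contra hf
        rw [Bool.not_eq_true] at hf
        have hc : clauseOf (atomList ψ) n vs (maskOf (atomList ψ) n vs σ) ∈ matrixClauses R ψ vs :=
          (mem_matrixClauses_iff ψ vs _).2 ⟨_, maskOf_lt _ n vs σ, hf, rfl⟩
        exact (eval_clauseOf_eq_true_iff _ n vs σ (maskOf_lt _ n vs σ)).1 (h _ hc) rfl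
      · intro h c hc
        obtain ⟨t, ht, hf, rfl⟩ := (mem_matrixClauses_iff ψ vs c).1 hc
        refine (eval_clauseOf_eq_true_iff _ n vs σ ht).2 ?_
        rintro rfl
        rw [h] at hf
        exact Bool.noConfusion hf
    rw [key, evalB_eq_decide_realizesB (atomList ψ) _ hq vs hl hvs (fun κ hκ => maskVal_maskOf ψ vs hl hvs σ κ hκ),
      decide_eq_true_iff]
  | @all l f hf ih =>
    intro vs hl hvs
    rw [clausesB_all]
    simp only [List.mem_flatMap, List.mem_range, forall_exists_index, and_imp]
    constructor
    · intro h x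
      have e := xsOf_append vs hl hvs x x.2
      have h' := (ih (vs ++ [(x : ℕ)]) (by simp [hl]) (forall_lt_append_singleton hvs x.2)).1
        (fun c hc => h c x x.2 hc)
      rw [e] at h'
      exact h'
    · intro h c a ha hc
      refine (ih (vs ++ [a]) (by simp [hl]) (forall_lt_append_singleton hvs ha)).2 ?_ c hc
      rw [xsOf_append vs hl hvs a ha]
      exact h ⟨a, ha⟩

end Semantics

/-! ### The CNF of an SNP formula on an instance -/

section Instance

open scoped Classical

variable (Φ : SNPFormula) {n : ℕ} (R : RelTables Φ.inputArities n)

/-- **THE CNF OF AN SNP FORMULA ON AN INSTANCE** `⟨n, R⟩`. [cite: ImpagliazzoPaturiZaneJCSS2001, §3, proof of Thm. 3] -/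
def cnfOf : CNF ℕ := clausesB R Φ.sentence []

/-- **Correctness of the reduction**: the CNF is satisfiable iff the SNP formula holds on the
instance — a satisfying assignment is a table of witnesses read at the bit positions, and conversely.
[cite: ImpagliazzoPaturiZaneJCSS2001, §3, proof of Thm. 3] -/
theorem satisfiable_cnfOf_iff : (cnfOf Φ R).Satisfiable ↔ Φ.HoldsOnTables n R := by
  have hnil : ∀ x ∈ ([] : List ℕ), x < n := fun _ h => (List.not_mem_nil h).elim
  have hxs : (xsOf (n := n) ([] : List ℕ) rfl hnil : Fin 0 → Fin n) = default := Subsingleton.elim _ _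
  have key : ∀ σ : ℕ → Bool, (cnfOf Φ R).eval σ = true ↔
      @FirstOrder.Language.Sentence.Realize _ (Fin n)
        (@FirstOrder.Language.sumStructure _ _ (Fin n) (structureOfTables R)
          (structureOfTables (tablesOfAssignment Φ.witnessArities n σ))) Φ.sentence := by
    intro σ
    rw [CNF.eval_eq_true_iff, cnfOf, forall_eval_clausesB_iff Φ.isUniversal σ [] rfl hnil, RealizesB, hxs]
    rfl
  rw [Φ.holdsOnTables_iff]
  constructor
  · rintro ⟨σ, hσ⟩
    exact ⟨_, (key σ).1 hσ⟩
  · rintro ⟨W, hW⟩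
    refine ⟨assignmentOfTables W, (key _).2 ?_⟩
    rw [tablesOfAssignment_assignmentOfTables]
    exact hW

/-- **Every clause has exactly `widthOf` literals**; in particular the CNF is a `k`-CNF for every
`k ≥ widthOf`. [cite: ImpagliazzoPaturiZaneJCSS2001, §3, proof of Thm. 3] -/
theorem isWidthLE_cnfOf {k : ℕ} (hk : widthOf Φ.sentence ≤ k) : (cnfOf Φ R).IsWidthLE k :=
  fun _ hc => (length_of_mem_clausesB Φ.sentence [] hc).le.trans hk

/-- **The variables are bit positions**: `numVars ≤ witnessBits n`. [cite: ImpagliazzoPaturiZaneJCSS2001, §3, proof of Thm. 3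
("exactly `Σᵢ n^{αᵢ}` variables, the complexity parameter")] -/
theorem numVars_cnfOf_le : (cnfOf Φ R).numVars ≤ Φ.witnessBits n := by
  rw [SerfRename.numVars_le_iff, SNPFormula.witnessBits_eq_tableBits]
  intro lit hlit
  obtain ⟨c, hc, hl⟩ := List.mem_flatten.1 hlit
  exact lt_of_mem_clausesB Φ.sentence [] rfl (fun _ h => (List.not_mem_nil h).elim) hc hl

end Instance

/-! ### The reduction map on strings -/

section Reduction

open scoped Classical

variable (ar : List ℕ)

/-- Test 1: the input is a well-formed pair. [folklore] -/
noncomputable def test1 : List Bool → List Bool := eqPairFn ∘ fanoutFn rePair id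
/-- Test 2: its first component is a canonical numeral. [folklore] -/
noncomputable def test2 : List Bool → List Bool := eqPairFn ∘ fanoutFn (norm ∘ fstP) fstP
/-- Test 3: the universe size is at most the input length (`¬ (|x| + 1 ≤ n)`, unary-versus-binary
comparison `unLeBinFn`). [folklore] -/
noncomputable def test3 : List Bool → List Bool := notFn (unLeBinFn ∘ fanoutFn (List.cons true) fstP)
/-- Test 4: the table segment has the right length (`|sndP x| = tableBits ar n`, compared in unary with
the capped `tbU` of `ESOVerifier.lean` on `⟨x, ε⟩`). [folklore] -/
noncomputable def test4 : List Bool → List Bool :=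
  eqPairFn ∘ fanoutFn (Plumb.polyFn X ∘ sndP) (tbU ar ∘ fanoutFn id (fun _ => []))

/-- The four tests are in `FP`. [folklore] -/
theorem tests_mem_FP : test1 ∈ FP ∧ test2 ∈ FP ∧ test3 ∈ FP ∧ test4 ar ∈ FP :=
  ⟨comp_mem_FP eqPairFn_mem_FP (fanoutFn_mem_FP rePair_mem_FP OracleCompose.id_mem_FP),
   comp_mem_FP eqPairFn_mem_FP (fanoutFn_mem_FP (comp_mem_FP norm_mem_FP fstP_mem_FP) fstP_mem_FP),
   notFn_mem_FP (comp_mem_FP unLeBinFn_mem_FP (fanoutFn_mem_FP (cons_mem_FP true) fstP_mem_FP)),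
   comp_mem_FP eqPairFn_mem_FP (fanoutFn_mem_FP (comp_mem_FP (Plumb.polyFn_mem_FP _) sndP_mem_FP)
     (comp_mem_FP (tbU_mem_FP ar) (fanoutFn_mem_FP OracleCompose.id_mem_FP (const_mem_FP _))))⟩

/-- The four tests are one-bit. [folklore] -/
theorem oneBit_tests : OneBit test1 ∧ OneBit test2 ∧ OneBit test3 ∧ OneBit (test4 ar) :=
  ⟨oneBit_eqPairFn.comp _, oneBit_eqPairFn.comp _, oneBit_notFn fun _ => ⟨_, rfl⟩, oneBit_eqPairFn.comp _⟩

variable (Φ : SNPFormula)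

/-- The main branch: `x ↦ ⟨unary count, list code⟩` computed on the argument word `⟨⟨x, ε⟩, codeL []⟩`. [folklore] -/
noncomputable def mainFn : List Bool → List Bool :=
  fanoutFn (cntFn Φ.sentence) (bodyFn Φ.sentence) ∘ fanoutFn (fanoutFn id (fun _ => [])) (fun _ => [])

/-- `mainFn Φ ∈ FP`. [folklore] -/
theorem mainFn_mem_FP : mainFn Φ ∈ FP :=
  comp_mem_FP (fanoutFn_mem_FP (cntFn_mem_FP _) (bodyFn_mem_FP _))
    (fanoutFn_mem_FP (fanoutFn_mem_FP OracleCompose.id_mem_FP (const_mem_FP _)) (const_mem_FP _))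

/-- **THE REDUCTION MAP** from codes of `Φ`-instances to codes of CNFs: the four validity tests, then the
main branch; invalid strings go to the non-member `badCode`. [cite: ImpagliazzoPaturiZaneJCSS2001, §3, Thm. 3
(the strong many-one reduction from an SNP problem to `k`-SAT)] -/
noncomputable def redFn : List Bool → List Bool :=
  iteFn test1 (iteFn test2 (iteFn test3 (iteFn (test4 Φ.inputArities) (mainFn Φ) (fun _ => KSATRed.badCode))
    (fun _ => KSATRed.badCode)) (fun _ => KSATRed.badCode)) (fun _ => KSATRed.badCode)

/-- **The reduction map is polynomial time.** [cite: ImpagliazzoPaturiZaneJCSS2001, §3, Thm. 3 ("strong many-one reduction")] -/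
theorem redFn_mem_FP : redFn Φ ∈ FP := by
  obtain ⟨h1, h2, h3, h4⟩ := tests_mem_FP Φ.inputArities
  exact iteFn_mem_FP h1 (iteFn_mem_FP h2 (iteFn_mem_FP h3 (iteFn_mem_FP h4 (mainFn_mem_FP Φ) (const_mem_FP _))
    (const_mem_FP _)) (const_mem_FP _)) (const_mem_FP _)

/-- Value of the reduction map through the tests. [folklore] -/
theorem redFn_eq (x : List Bool) :
    redFn Φ x = if test1 x = [true] ∧ test2 x = [true] ∧ test3 x = [true] ∧ test4 Φ.inputArities x = [true]
      then mainFn Φ x else KSATRed.badCode := by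
  obtain ⟨o1, o2, o3, o4⟩ := oneBit_tests Φ.inputArities
  simp only [redFn, iteFn_of_oneBit o1, iteFn_of_oneBit o2, iteFn_of_oneBit o3, iteFn_of_oneBit o4]
  by_cases h1 : test1 x = [true] <;> by_cases h2 : test2 x = [true] <;> by_cases h3 : test3 x = [true] <;>
    by_cases h4 : test4 Φ.inputArities x = [true] <;> simp [h1, h2, h3, h4]

variable {ar Φ}

/-- **The tests pass exactly on the codes of instances** (non-degenerate vocabulary: a passing string is
`boolPair (bin n) t` with `n ≤ |x|` and `|t| = tableBits ar n`, i.e. the code of `⟨n, tablesOfBits t⟩`).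
[folklore] -/
theorem tests_iff (har : IsNondegenerateVocab ar) (x : List Bool) :
    (test1 x = [true] ∧ test2 x = [true] ∧ test3 x = [true] ∧ test4 ar x = [true]) ↔
      ∃ (n : ℕ) (R : RelTables ar n), x = codeOf R := by
  have e1 : test1 x = [true] ↔ rePair x = x := by
    simp [test1, fanoutFn_apply, eqPairFn_boolPair]
  have e2 : test2 x = [true] ↔ norm (fstP x) = fstP x := by
    simp [test2, fanoutFn_apply, eqPairFn_boolPair]
  have e3 : ∀ m : ℕ, fstP x = encodeNat m → (test3 x = [true] ↔ m ≤ x.length) := fun m hm => by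
    rw [test3, notFn_apply (b := decide (x.length + 1 ≤ m)) (by
      simp only [Function.comp_apply, fanoutFn_apply, hm, unLeBinFn_boolPair, List.length_cons])]
    simp only [List.cons.injEq, and_true, Bool.not_eq_true', decide_eq_false_iff_not, not_le]
    omega
  have e4 : ∀ m : ℕ, fstP x = encodeNat m → m ≤ x.length →
      (test4 ar x = [true] ↔ (sndP x).length = tableBits ar m) := fun m hm hle => by
    have hn : nOf (boolPair x []) = m := by
      show bitsToNat (fstP (fstP (boolPair x []))) = m
      rw [fstP_boolPair, hm, bitsToNat_encodeNat]
    have hcap : nOf (boolPair x []) ≤ (boolPair x []).length := by rw [hn, length_boolPair]; omega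
    simp only [test4, Function.comp_apply, fanoutFn_apply, id, eqPairFn_boolPair, Plumb.polyFn_apply, eval_X,
      tbU_of_le ar hcap, hn, List.cons.injEq, and_true, decide_eq_true_eq]
    constructor
    · intro h; simpa [ones] using congrArg List.length h
    · intro h; rw [h]
  constructor
  · rintro ⟨h1, h2, h3, h4⟩
    obtain ⟨m, hx⟩ := (rePair_and_norm_and_sndP_iff (sndP x) x).1 ⟨e1.1 h1, e2.1 h2, rfl⟩
    have hm : fstP x = encodeNat m := by rw [hx, fstP_boolPair]
    have hle := (e3 m hm).1 h3
    have ht := (e4 m hm hle).1 h4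
    refine ⟨m, tablesOfBits ar m (sndP x) ht, ?_⟩
    rw [codeOf, show (encodingSNPInstance ar).encode ⟨m, tablesOfBits ar m (sndP x) ht⟩ =
      boolPair (encodeNat m) ((encodingRelTables ar m).encode (tablesOfBits ar m (sndP x) ht)) from rfl,
      encode_tablesOfBits]
    exact hx
  · rintro ⟨n, R, rfl⟩
    have hm : fstP (codeOf R) = encodeNat n := by rw [codeOf_eq, fstP_boolPair]
    have hle : n ≤ (codeOf R).length := by
      rw [length_codeOf]; have := le_tableBits_of_isNondegenerateVocab har n; omega
    refine ⟨e1.2 (by rw [codeOf_eq, rePair_boolPair]), e2.2 (by rw [hm, norm_encodeNat]), (e3 n hm).2 hle,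
      (e4 n hm hle).2 ?_⟩
    rw [codeOf_eq, sndP_boolPair, List.length_ofFn]

/-- **The reduction map on the code of an instance**: the code of `cnfOf Φ R`.
[cite: ImpagliazzoPaturiZaneJCSS2001, §3, proof of Thm. 3] -/
theorem redFn_codeOf (har : IsNondegenerateVocab Φ.inputArities) {n : ℕ} (R : RelTables Φ.inputArities n) :
    redFn Φ (codeOf R) = encodingCNF.encode (cnfOf Φ R) := by
  rw [redFn_eq, if_pos ((tests_iff har _).2 ⟨n, R, rfl⟩)]
  have hz : n ≤ (zOf R).length := n_le_length_zOf R har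
  have hnil : ∀ x ∈ ([] : List ℕ), x < n := fun _ h => (List.not_mem_nil h).elim
  have e : mainFn Φ (codeOf R) =
      boolPair (cntFn Φ.sentence (boolPair (zOf R) (codeL []))) (bodyFn Φ.sentence (boolPair (zOf R) (codeL []))) := by
    -- `rw`, not `simp`: a `simp`-generated congruence proof around the structurally recursive `cntFn`/`bodyFn`
    -- makes the kernel unfold them (excessive memory)
    rw [mainFn, Function.comp_apply, fanoutFn_apply, fanoutFn_apply, fanoutFn_apply]
    rfl
  have e2 : encodingCNF.encode (cnfOf Φ R) =
      boolPair (unaryEncodeNat (clausesB R Φ.sentence []).length)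
        (encList ((clausesB R Φ.sentence []).map encodingClause.encode)) :=
    listBool_encode_eq_encList encodingClause (clausesB R Φ.sentence [])
  rw [e, e2, cntFn_arg hz Φ.sentence [] rfl hnil, bodyFn_arg hz Φ.sentence [] rfl hnil,
    OracleCompose.unaryEncodeNat_eq_replicate]

/-- The reduction map on a string that is not the code of an instance. [folklore] -/
theorem redFn_of_not_code (har : IsNondegenerateVocab Φ.inputArities) {x : List Bool}
    (hx : ¬ ∃ (n : ℕ) (R : RelTables Φ.inputArities n), x = codeOf R) : redFn Φ x = KSATRed.badCode := by
  rw [redFn_eq, if_neg (mt (tests_iff har x).1 hx)]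

end Reduction

/-! ### The SERF reduction -/

section Serf

open scoped Classical

/-- Membership in the language of `Φ` is being a code of a model. [folklore] -/
theorem mem_language_iff_exists (Φ : SNPFormula) (x : List Bool) :
    x ∈ Φ.language ↔ ∃ (n : ℕ) (R : RelTables Φ.inputArities n), x = codeOf R ∧ Φ.HoldsOnTables n R := by
  constructor
  · rintro ⟨⟨n, R⟩, hR, rfl⟩
    exact ⟨n, R, rfl, hR⟩
  · rintro ⟨n, R, rfl, hR⟩
    exact ⟨⟨n, R⟩, hR, rfl⟩

/-- **Every SNP problem over a non-degenerate input vocabulary SERF-reduces to `k`-SAT** with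
`k = max A 3`, `A` the number of distinct witness atoms of the matrix (Impagliazzo–Paturi–Zane: the
strong many-one reduction `redFn` — instance code ↦ code of the truth-table `A`-CNF over the witness
bits — is a SERF reduction with parameter constant `1`, `numVars ≤ witnessBits`).
[cite: ImpagliazzoPaturiZaneJCSS2001, §3, Thm. 3 and the preceding theorem ("every `A ∈ SNP` has a strong
many-one reduction to `k`-SAT with parameter `n`")] -/
theorem serfReducible_snp_kSATParam (Φ : SNPFormula) (har : IsNondegenerateVocab Φ.inputArities) :
    SERFReducible Φ.toParamProblem (kSATParam (max (widthOf Φ.sentence) 3)) := by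
  set k := max (widthOf Φ.sentence) 3 with hk
  refine serfReducible_of_karp (redFn Φ) (redFn_mem_FP Φ) (fun x => ?_) 1 (fun x => ?_)
  · show x ∈ Φ.language ↔ redFn Φ x ∈ kSAT k
    by_cases hx : ∃ (n : ℕ) (R : RelTables Φ.inputArities n), x = codeOf R
    · obtain ⟨n, R, rfl⟩ := hx
      rw [redFn_codeOf har R, mem_kSAT_iff, SNPRed.satisfiable_cnfOf_iff, mem_language_iff_exists]
      constructor
      · rintro ⟨n', R', he, hR'⟩
        have hinj : (⟨n, R⟩ : SNPInstance Φ.inputArities) = ⟨n', R'⟩ :=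
          (encodingSNPInstance Φ.inputArities).encode_injective he
        cases hinj
        exact ⟨isWidthLE_cnfOf Φ R (le_max_left _ _), hR'⟩
      · rintro ⟨-, hR⟩
        exact ⟨n, R, rfl, hR⟩
    · rw [redFn_of_not_code har hx]
      constructor
      · intro h
        obtain ⟨n, R, rfl, -⟩ := (mem_language_iff_exists Φ x).1 h
        exact (hx ⟨n, R, rfl⟩).elim
      · intro h; exact (KSATRed.badCode_not_mem_kSAT k h).elim
  · by_cases hx : ∃ (n : ℕ) (R : RelTables Φ.inputArities n), x = codeOf R
    · obtain ⟨n, R, rfl⟩ := hx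
      rw [redFn_codeOf har R, kSATParam_param_encode, one_mul, codeOf, SNPFormula.toParamProblem_param_encode]
      exact numVars_cnfOf_le Φ R
    · rw [redFn_of_not_code har hx, SerfRename.param_badCode]
      exact Nat.zero_le _

end Serf

end SNPRed


/-! ### The discharge -/

/-- **Discharge of `forall_kSATParam_mem_SE_iff_SNP_subset_SE`** (Impagliazzo–Paturi–Zane 2001, Thm. 3:
`k`-SAT, `k ≥ 3`, is SNP-complete under SERF reductions with respect to the witness-size parameter, hence
`k`-SAT ∈ SE for all `k ≥ 3` iff SNP ⊆ SE). `(→)`: an SNP problem over a non-degenerate input vocabulary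
SERF-reduces to `(max A 3)`-SAT (`SNPRed.serfReducible_snp_kSATParam`, the printed strong many-one
reduction) and `SE` is closed under SERF reductions (`mem_SE_of_serfReducible_holds`); over a degenerate
vocabulary its language is in `P ⊆ SE` (`SNPFormula.language_mem_P_of_arities_eq_zero`,
`mem_SE_of_lang_mem_P`). `(←)`: `k`-SAT is (SERF-reducible to) an SNP problem (`exists_snp_kSAT_holds`) and
`SE` is closed under SERF reductions. [cite: ImpagliazzoPaturiZaneJCSS2001, §3 Thm. 3] -/
theorem forall_kSATParam_mem_SE_iff_SNP_subset_SE_holds : forall_kSATParam_mem_SE_iff_SNP_subset_SE := by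
  constructor
  · rintro h Q ⟨Φ, rfl⟩
    by_cases har : IsNondegenerateVocab Φ.inputArities
    · exact mem_SE_of_serfReducible_holds (SNPRed.serfReducible_snp_kSATParam Φ har) (h _ (le_max_right _ _))
    · refine mem_SE_of_lang_mem_P (Φ.language_mem_P_of_arities_eq_zero fun i => ?_)
      have hi : ¬ (1 ≤ Φ.inputArities.get i) := fun h1 => har ⟨_, List.get_mem _ i, h1⟩
      omega
  · intro h k _
    obtain ⟨Φ, h₁, -⟩ := exists_snp_kSAT_holds k
    exact mem_SE_of_serfReducible_holds h₁ (h ⟨Φ, rfl⟩)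

end Literature.Computability.FineGrained
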